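import Summits.Langlands.Langlands.Theses.QuadraticWindow
import Literature.NumberTheory.GaloisRepresentations.IntegralGaloisActionProofs
import Literature.NumberTheory.GaloisRepresentations.SatakeFamilyOfFramedGaloisRep
import Literature.NumberTheory.Automorphic.BaseChangeInductionAlong
import Literature.NumberTheory.Automorphic.AutomorphicRepsGLSatakeFlathProofs
import Literature.NumberTheory.Automorphic.AshSmithTheoryHeckeFrobeniusProofs
import Literature.NumberTheory.Automorphic.AshSmithTheoryHeckeProofs
import Literature.NumberTheory.Automorphic.ReciprocityGLnDescentProofs
import Summits.Langlands.Langlands.Theorems.IrreducibilityBySelfDualityIrreducibleGL3CMContinuousSemisimplification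
import Literature.NumberTheory.Automorphic.ReciprocityGLnRankOneProofs
import Literature.NumberTheory.Automorphic.StrongArtinGL2
import Literature.NumberTheory.GaloisRepresentations.FramedRepTwist
import Literature.NumberTheory.GaloisRepresentations.ModNCyclotomicCharacter
import Literature.NumberTheory.Automorphic.AsaiSign
import Literature.NumberTheory.GaloisRepresentations.FrobeniusDensityTheorem

/-!
# Disproof of `HostInducedRep` — standing adversary work file (crux `stmt-Langlands-10902`)

Crux: `Summit.Langlands.Langlands.Theses.QuadraticWindow.HostInducedRep` (route
`route-Langlands-QuadraticWindow`, rank 3).  This is the gen-5 (cycle 5) state of the `cdisprove`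
seat's file, EXTENDING the published gen-4 file in place (§§1–8bis are gen-1..3 content, §§9–12 gen-4,
all re-checked rc 0 against the current tree on 2026-08-16; §13 is gen-5: the `-- Targets` pass over
the stubs of the two filed lines).  It is SELF-CONTAINED (the gen-1/gen-2 files live only as item
evidence `run/gate/evidence/stmt-Langlands-10902/*-Disproof.lean`, not mounted in worker jails).

## Findings (index; `L` = proved below in Lean, `P` = paper, in docstrings)

VERDICT: resists.  No counterexample can be typed: every hypothesis needs a genuine
`CuspidalAutomorphicRepData n F hcpt` with Satake data at infinitely many places (`n ≥ 1` is
forced, `pos_of_twistNontrivial`).  The strata `n = 0` (§1) and **`n = 1` (§12, gen-4: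
`hostInducedRepAt_one : HostInducedRepAt 1`, PROVED, standard axioms)** are theorems of Lean; the
stratum `n = 2` is a theorem in print (§10, gen-4); for every `n` the statement is EXACTLY
place-by-place reciprocity for the twists `π ⊗ ψ̃⁻¹` over `F` composed with index-two Galois
induction (§9, gen-4), i.e. TRUE under conjunct (A) + unramified local–global compatibility
(`R = Ind_{Γ_F}^{Γ_{F₀}}(ρ_π ⊗ ẽψ⁻¹)`).

* §1 `L` anatomy: `HostInducedRep ↔ ∀ n, HostInducedRepAt n`; the twist-nontriviality hypothesis
  forces `0 < n` (`pos_of_twistNontrivial`), so the `n = 0` stratum holds vacuously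
  (`hostInducedRepAt_zero`) — gen-1 §1 re-derived.
* §1b `L` NEW (gen-3) EXACT REDUNDANCIES, as equivalences a planner may apply verbatim:
  (R1) `HostInducedRepWithoutTau ↔ HostInducedRep` — the hypothesis `τ ≠ 1` is implied by the
  others (at `τ = 1` the twist-nontriviality hypothesis dies by uniqueness of Satake parameters,
  `AutomorphicRepData.hasSatakeParamAt_unique_holds` — a PROVED theorem of the tree (Flath), which
  gen-2 still listed as unproved — and of Frobenius polynomials); (R2)
  `HostInducedRepSlimGuard ↔ HostInducedRep` — the guard clause `eψ.IsUnramifiedAt w` is implied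
  by the Frobenius clause next to it (rank one, `isUnramifiedAt_of_hasFrobCharpolyAt_rankOne`).
* §2 `L` Frobenius side: Frobenius char-polys are unique and have degree = rank
  (`hasFrobCharpolyAt_unique'`, `natDegree_eq_rank_of_hasFrobCharpolyAt`,
  `not_hasFrobCharpolyAt_of_natDegree_ne` — the RANK OBSTRUCTION of gen-1 §4: the finprod in the
  conclusion must have degree exactly `2n`, which is what makes `finrank F₀ F = 2` and the guard
  `ramificationIdx = 1` load-bearing, see `natDegree_hostPoly_eq_two_mul` in §3b).
* §3 `L` fibre bookkeeping: the fibre of `v` is finite and nonempty, the finprod is a `Finset`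
  product, monic, of degree `n * ∑_{w ∣ v} f(w ∣ v)`.  §3b `L` (gen-1 §7 re-derived) the
  quadratic fibre: `Gal(F/F₀) = {1, τ}` (`aut_eq_one_or_eq`), fibre `= {w, τ • w}`
  (`fibre_eq_pair`), `∑_{w∣v} f = 2` under the guard (`sum_inertiaDeg_eq_two`, fundamental
  identity), hence degree `2n` (`natDegree_hostPoly_eq_two_mul`); inert `v`: one factor `P_w(X²)`
  (`hostPoly_of_smul_eq`, `f = 2`); split `v`: `P_w · P_{τw}` (`hostPoly_of_smul_ne`, `f = 1`).
* §4 `L` NEW (gen-3) the two matrix identities the induced witness must satisfy: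
  split `v`: `charpoly (fromBlocks A 0 0 B) = charpoly A * charpoly B`; inert `v`:
  `charpoly (fromBlocks 0 A 1 0) = expand 2 (charpoly A)` (`charpoly_fromBlocks_zero_one`, any
  commutative ring) — i.e. `det(X - Ind σ) = det(X^f - r(σ^f))`; with §3b the shape
  `∏_{w∣v} P_w(X^{f(w∣v)})` of the crux is exactly the characteristic polynomial of
  `Ind_{Γ_F}^{Γ_{F₀}}(r)(Frob_v)` at every good `v` (gen-1 §7 said so on paper; now lemmas).
* §5 `L` WITNESS-FREE REDUCTION (gen-2 §2 re-derived): `HostInducedRep` ⊢ uniqueness of the Satake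
  parameter of `π` at every place `w` over a good `v` (`satake_unique_of_hostInducedRep`): the
  `∀ α` packaging of the conclusion CONSUMES Satake uniqueness.  Correction to gen-2: this input is
  available, `AutomorphicRepData.hasSatakeParamAt_unique_holds` (standard axioms, checked), so §5
  costs a prover nothing; it only documents that the packaging is not weaker than it looks.
* §6 `L`+`P` NEW (gen-3) CONTROL SET: the crux demands unramified compatibility at EVERY place
  `v ∤ ℓ` of `F₀` unramified in `F` with `π`, `eψ` unramified above `v`; the cited engine
  (Goldring–Koskivirta, arXiv:1507.05032 Thm 3.5.5, p. 19, with `Ram(G) ∪ Ram(π)` a set of RATIONAL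
  primes, p. 9 and p. 14) delivers it only at places over rational primes `p ∉ Ram(G) ∪ Ram(π')`,
  and `Ram(G) ⊇ {p ∣ disc F₀}` for `G = GU_{K/F₀}(n,n)` viewed over `ℚ`.  So at a place `v` of `F₀`
  over a prime ramified in `F₀/ℚ` (e.g. `F₀ = ℚ(√3)`, `v ∣ 3`, `F/F₀` unramified at `v`) the crux
  asks for something no cited theorem provides, for every `π`.  `HostInducedRepRatControl` is the
  weakening that matches the engine; `HostInducedRep → HostInducedRepRatControl` (trivial), and the
  weak form still feeds a COFINITE `TwistUnpackaging` (paper: the lost places lie over a fixed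
  finite set of rational primes).  Not a refutation (true under full LGC) — a provability gap to
  be fixed by the planner (repair text in §6).
* §7 `P` hypothesis ledger (all generations): `hTR`, `hτ`, `hpar`, `hodd`, `hℓ`, `hunr`, `hψunr`,
  `hψpar` are NOT needed for TRUTH (statement ⇐ reciprocity + unramified LGC for any `F`, any RA
  cuspidal `π`); `hdeg` and the ramification guard are load-bearing (rank obstruction §2/§3);
  `hreg` is load-bearing (gen-1 §5: `n = 1`, non-algebraic unitary `τ`-anti-invariant Hecke
  character — compact image forces unit Frobenius eigenvalues while some Satake value is
  transcendental); `hψnti`/`hnti` only exclude `n = 0` as far as truth goes (for `τ`-invariant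
  `π ⊗ ψ⁻¹` the induced representation still exists).  They ARE needed by the ENGINE (cuspidality
  of `AI`, parity for BLGGT A.2.5, sign law), see the gen-1/gen-2 evidence notes on the item.
* §8 `P` engine risks that would NOT refute the typed item even if realised: (a) archimedean sign
  law (descent of `Π_K ⊗ ψ₀` to `U(n,n)` lands in the LDS packet iff the twisted exponents are in
  `½ + ℤ`; the doubled parameter `⊕ 2χ_i` carries both conjugate-duality signs, so the global sign
  is pinned by `η_v(-1)·(-1)^w`, uniformly in `v` only if parity is constant on ALL real places of
  `F₀` — typed only on the split ones; automatic for odd `n`); (b) Kottwitz datum for quasi-split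
  `GU(n,n)`, `B = K`; (c) `U → GU` and patching; (d) = §6.  §8bis (end of file) refines (a): two
  conjugate-symplectic descent classes differing by `ω ω_K` ⇒ on SPLIT real places constancy of
  parity (either sign, = `hpar`) is what the engine needs and `hodd` looks droppable; on NON-split
  places one parity law, automatic for odd `n`, open for even `n`.

* §9 `L` NEW (gen-4) AXIOM SHAPE: `HostInducedRep ↔ HostInducedRepVia HostConclusion` (the crux's
  telescope with a swappable conclusion, `Iff.rfl`), and
  `hostInducedRep_of_reciprocity_of_induction : HostInducedRepVia TwistedStrongReciprocityAt →
  (∀ quadratic F/F₀, HasQuadraticInduction) → HostInducedRep` — the crux is EXACTLY place-by-place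
  reciprocity for the twists `π ⊗ ψ̃⁻¹` over `F` (conjunct (A), strong form, one representation at a
  time) composed with index-two Galois induction; no other hypothesis of the crux is consumed.  Typed
  form of "restates the target / unrefutable by design": a counterexample to the crux would be a
  counterexample to reciprocity-with-unramified-compatibility for a regular algebraic cuspidal
  representation of `GL_n/F`.
* §10 `P` NEW (gen-4) RANK-TWO STRATUM IS IN PRINT, first new rank is `3`, first rank where the
  engine's residual sign law (§8bis) is open is `4`; nearest prior art for the engine's
  "base change to `K′F₀` and twist" step: Blasius–Rogawski (M = FK, all weights incl.
  non-paritious), Dembélé–Loeffler–Pacetti arXiv:1612.06625 Thm 3.2/3.5.  See §10 (end of file).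
* §11 `L` NEW (gen-4) `hasQuadraticInduction_one`: the Galois half of §9 is a THEOREM in rank one
  (tree: `FramedGaloisRep.induce`, Ash's `exists_charpoly_induce_eq_prod`, `isUnramifiedAt_induce`,
  `inertia_le_range_absGaloisRestrict`, continuous semisimplification of the sibling route
  `IrreducibleGL3CM`); hence `hostInducedRepAt_one_of_reciprocity`.
* §12 `L` NEW (gen-4) **`hostInducedRepAt_one : HostInducedRepAt 1` PROVED** — the automorphic
  half in rank one is Weil's `ℓ`-adic character of `χ_π` (`HeckeCharacter.IsAlgebraic.exists_lAdic`)
  twisted (`FramedRep.twist`) by the locally constant character `ι⁻¹ ∘ (det eψ)⁻¹` (finite image of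
  Artin characters, `finite_range_toMonoidHom`); no class field theory for `eψ` is needed because the
  crux reads `ψ` only through `eψ`'s Frobenius values.  Landable verbatim by a prover as a
  `--supports` theorem (a refuter cannot write under `Theorems/`; standalone extract attached to the
  item as evidence `HostInducedRepRankOne.lean`).  Corollary `hostInducedRep_iff_forall_two_le :
  HostInducedRep ↔ ∀ n ≥ 2, HostInducedRepAt n` — the OPEN content of the crux starts at `n = 3`
  (`n = 2` being in print, §10).

* §13 `L`+`P` NEW (gen-5) `-- Targets`: verdicts on the 7 stubs of `Lines/one-transparent-pane.lean`
  (registered skeleton) and the 5 of `Lines/grs-explicit-descent.lean` — all TRUE IN NATURE as far as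
  checked (no stub-false), with ONE typed hazard that is load-bearing for both lines: the tree's
  `HasAsaiPole`/`HasAsaiSign` are limits of the RAW partial Asai Euler product (`tprod`, junk `1`),
  i.e. RAMANUJAN-STRENGTH in rank `≥ 3` (`not_hasAsaiPole_of_frequently_not_multipliable`; tree file
  `AsaiSignContinuation.lean`), so the sign obligations `HasAsaiSign … 1` the lines must PRODUCE are
  dischargeable only modulo the (over-strong) named fact `Mok2014_partialAsaiL_pole_dichotomy` —
  thread it as a hypothesis.  Lean: vacuity of the typed pole without Asai data
  (`hasAsaiSign_of_forall_not_isAsaiDatum`) and its cure `exists_isAsaiDatum` (Flath + different, a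
  positive helper `stub_paneLaw` needs); `SignPin` (= `stub_signPin` verbatim) proves the UNIQUENESS
  half of Mok's dichotomy for pane-type `P` (`SignPin.sign_unique`, `signPin_cosets_disjoint`);
  `stub_totallyRealInduction` in rank one holds for every `F` (`hostConclusion_rank_one`).
  LANDED (p74538, accepted): `Summits/Langlands/Langlands/Theorems/HostInducedRep/Negative/AsaiSignHazard.lean`
  — `exists_isAsaiDatum`, `inertiaDeg_eq_two_of_smul_eq_of_isUnramifiedIn`,
  `hasAsaiPole/Sign_of_forall_not_isAsaiDatum`, `not_hasAsaiPole_of_frequently_not_multipliable`,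
  `signPin_cosets_disjoint`, `asaiSign_unique_of_signPin`, `exists_isAsaiDatum_of_signPin`
  (namespace `Summit.Langlands.Langlands.Theorems.HostInducedRep.Negative`; ideators/planners/lead
  may `import Summits.Langlands.Langlands.Theorems.HostInducedRep.Negative.AsaiSignHazard`).

Every `theorem` below is sorry-free; `lean check` rc 0; axioms ⊆ {propext, Classical.choice,
Quot.sound}.
-/

open scoped BigOperators Polynomial
open Filter Set Function Polynomial IsDedekindDomain NumberField
open Literature.NumberTheory.Automorphic Literature.NumberTheory.GaloisRepresentations

set_option linter.dupNamespace false

noncomputable section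

namespace Summit.Langlands.Langlands.Cruxes.HostInducedRep.Disproof

open Summit.Langlands.Langlands.Theses.QuadraticWindow

/-! ## §1 Anatomy: the crux sliced by the rank `n`; the `n = 0` stratum -/

/-- The crux `HostInducedRep` with the rank `n` fixed (verbatim body otherwise). -/
def HostInducedRepAt (n : ℕ) : Prop :=
  ∀ (F₀ F : Type) [Field F₀] [NumberField F₀] [Field F] [NumberField F] [Algebra F₀ F] (τ : F ≃ₐ[F₀] F), NumberField.IsTotallyReal F₀ → Module.finrank F₀ F = 2 → τ ≠ 1 → ∀ (hcpt : Literature.NumberTheory.Automorphic.isCompact_glFiniteIntegralLevel n F) (π : Literature.NumberTheory.Automorphic.CuspidalAutomorphicRepData n F hcpt) (e : Literature.NumberTheory.GaloisRepresentations.FramedGaloisRep F₀ ℂ 1) (k : ℤ), π.1.IsRegularAlgebraic → (∀ᶠ w in Filter.cofinite, ∀ (α β : Multiset ℂ) (c : ℂ), π.1.HasSatakeParamAt w α → π.1.HasSatakeParamAt (τ • w) β → e.HasFrobCharpolyAt (w.under (NumberField.RingOfIntegers F₀)) (Polynomial.X - Polynomial.C c) → β = α.map (fun a ↦ a⁻¹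 * (c * ((w.under (NumberField.RingOfIntegers F₀)).residueCard : ℂ) ^ k) ^ w.asIdeal.inertiaDeg (NumberField.RingOfIntegers F₀))) → ((e.restrictField F).IsOdd ∨ ∀ (φ : F →+* ℝ) (c : Field.absoluteGaloisGroup F), Literature.NumberTheory.GaloisRepresentations.IsComplexConjugation φ c → Matrix.GeneralLinearGroup.det ((e.restrictField F) c) = 1) → (Odd n → (e.restrictField F).IsOdd) → ∀ (ℓ : ℕ) [Fact ℓ.Prime] (ι : PadicAlgCl ℓ ≃+* ℂ), ¬ ((ℓ : ℤ) ∣ NumberField.discr F) → (∀ w : IsDedekindDomain.HeightOneSpectrum (NumberField.RingOfIntegers F), ((ℓ : ℕ) : NumberField.RingOfIntegers F) ∈ w.asIdeal → π.1.IsUnramifiedAt w) → ∀ eψ : Literature.NumberTheory.GaloisRepresentations.FramedGaloisRep F ℂ 1, (∀ w : IsDedekindDomain.HeightOneSpectrum (NumberField.RingOfIntegers F), ((ℓ : ℕ) : NumberField.RingOfIntegers F) ∈ w.asIdeal → eψ.IsUnramifiedAt w) → (∀ (φ : F →+* ℝ) (c c' : Field.absoluteGaloisGroup F), Literature.NumberTheory.GaloisRepresentations.IsComplexConjugation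 φ c → Literature.NumberTheory.GaloisRepresentations.IsComplexConjugation (φ.comp (τ : F →+* F)) c' → Matrix.GeneralLinearGroup.det (eψ c) = Matrix.GeneralLinearGroup.det (eψ c')) → (∃ᶠ w in Filter.cofinite, ∃ (α β : Multiset ℂ) (c c' : ℂ), π.1.HasSatakeParamAt w α ∧ π.1.HasSatakeParamAt (τ • w) β ∧ eψ.HasFrobCharpolyAt w (Polynomial.X - Polynomial.C c) ∧ eψ.HasFrobCharpolyAt (τ • w) (Polynomial.X - Polynomial.C c') ∧ β.map (fun b ↦ b * c') ≠ α.map (fun a ↦ a * c)) → ∃ R : Literature.NumberTheory.GaloisRepresentations.FramedGaloisRep F₀ (PadicAlgCl ℓ) (2 * n), R.toGaloisRep.IsSemisimple ∧ ∀ (v : IsDedekindDomain.HeightOneSpectrum (NumberField.RingOfIntegers F₀)) (α : _ → Multiset ℂ) (c : _ → ℂ), ((ℓ : ℕ) : NumberField.RingOfIntegers F₀) ∉ v.asIdeal → (∀ w : IsDedekindDomain.HeightOneSpectrum (NumberField.RingOfIntegers F), w.under (NumberField.RingOfIntegers F₀) = v → w.asIdeal.ramificationIdx (NumberField.RingOfIntegers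 F₀) = 1 ∧ π.1.HasSatakeParamAt w (α w) ∧ eψ.IsUnramifiedAt w ∧ eψ.HasFrobCharpolyAt w (Polynomial.X - Polynomial.C (c w))) → R.IsUnramifiedAt v ∧ R.HasFrobCharpolyAt v (∏ᶠ w ∈ {w : IsDedekindDomain.HeightOneSpectrum (NumberField.RingOfIntegers F) | w.under (NumberField.RingOfIntegers F₀) = v}, Polynomial.expand (PadicAlgCl ℓ) (w.asIdeal.inertiaDeg (NumberField.RingOfIntegers F₀)) (Literature.NumberTheory.Automorphic.arithFrobPolyOfSatake ι w.residueCard n ((α w).map (fun a ↦ a * c w))))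

/-- Slicing by the rank is definitional: the crux is the conjunction of its rank strata. -/
theorem hostInducedRep_iff : HostInducedRep ↔ ∀ n, HostInducedRepAt n :=
  ⟨fun h n F₀ F _ _ _ _ _ τ hTR hdeg hτ => h F₀ F τ hTR hdeg hτ n,
    fun h F₀ F _ _ _ _ _ τ hTR hdeg hτ n => h n F₀ F τ hTR hdeg hτ⟩

/-- **The twist-nontriviality hypothesis forces `0 < n`.**  A Satake parameter has `card = n`
(`HasSatakeParamAt.card_eq`, definitional), so for `n = 0` all Satake parameters are `0` and the
hypothesis `∃ᶠ w, … β.map (· * c') ≠ α.map (· * c)` is unsatisfiable.  (Any filter; only one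
witness is used.) -/
theorem pos_of_twistNontrivial {n : ℕ} {F : Type} [Field F] [NumberField F]
    {hcpt : isCompact_glFiniteIntegralLevel n F} (π : CuspidalAutomorphicRepData n F hcpt)
    {l : Filter (HeightOneSpectrum (𝓞 F))} (g : HeightOneSpectrum (𝓞 F) → HeightOneSpectrum (𝓞 F))
    (P Q : HeightOneSpectrum (𝓞 F) → ℂ → Prop)
    (h : ∃ᶠ w in l, ∃ (α β : Multiset ℂ) (c c' : ℂ), π.1.HasSatakeParamAt w α ∧
      π.1.HasSatakeParamAt (g w) β ∧ P w c ∧ Q w c' ∧ β.map (fun b ↦ b * c') ≠ α.map (fun a ↦ a * c)) :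
    0 < n := by
  obtain ⟨w, α, β, c, c', hα, hβ, -, -, hne⟩ := h.exists
  by_contra hn
  obtain rfl : n = 0 := Nat.eq_zero_of_not_pos hn
  have hα0 : α = 0 := Multiset.card_eq_zero.mp hα.card_eq
  have hβ0 : β = 0 := Multiset.card_eq_zero.mp hβ.card_eq
  exact hne (by rw [hα0, hβ0, Multiset.map_zero, Multiset.map_zero])

/-- **The `n = 0` stratum of the crux holds** (vacuously: its twist-nontriviality hypothesis
fails by `pos_of_twistNontrivial`).  The summit carries `0 < n`; the crux does not need to. -/
theorem hostInducedRepAt_zero : HostInducedRepAt 0 := by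
  intro F₀ F _ _ _ _ _ τ _ _ _ hcpt π e k _ _ _ _ ℓ _ ι _ _ eψ _ _ hnti
  exact absurd (pos_of_twistNontrivial π (fun w ↦ τ • w)
    (fun w c ↦ eψ.HasFrobCharpolyAt w (X - C c)) (fun w c' ↦ eψ.HasFrobCharpolyAt (τ • w) (X - C c'))
    hnti) (lt_irrefl 0)

/-! ## §1b Exact redundancies: two simplifications of the statement that change nothing

(R1) the hypothesis `τ ≠ 1` is implied by the others: at `τ = 1` the twist-nontriviality
hypothesis is unsatisfiable, because Satake parameters are unique
(`AutomorphicRepData.hasSatakeParamAt_unique_holds`, a PROVED theorem of the tree — Flath) and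
Frobenius characteristic polynomials are unique (§2).  (R2) the guard clause `eψ.IsUnramifiedAt w`
of the conclusion is implied by the Frobenius clause next to it (§2, rank one).  Both are stated
as EQUIVALENCES with the crux, so a planner may drop them verbatim. -/

/-- The crux with the hypothesis `τ ≠ 1` dropped. -/
def HostInducedRepWithoutTau : Prop :=
  ∀ (F₀ F : Type) [Field F₀] [NumberField F₀] [Field F] [NumberField F] [Algebra F₀ F] (τ : F ≃ₐ[F₀] F), NumberField.IsTotallyReal F₀ → Module.finrank F₀ F = 2 → ∀ (n : ℕ) (hcpt : Literature.NumberTheory.Automorphic.isCompact_glFiniteIntegralLevel n F) (π : Literature.NumberTheory.Automorphic.CuspidalAutomorphicRepData n F hcpt) (e : Literature.NumberTheory.GaloisRepresentations.FramedGaloisRep F₀ ℂ 1) (k : ℤ), π.1.IsRegularAlgebraic → (∀ᶠ w in Filter.cofinite, ∀ (α β : Multiset ℂ) (c : ℂ), π.1.HasSatakeParamAt w α → π.1.HasSatakeParamAt (τ • w) β → e.HasFrobCharpolyAt (w.under (NumberField.RingOfIntegers F₀)) (Polynomial.X - Polynomial.C c) → β = α.map (fun a ↦ a⁻¹ * (c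 * ((w.under (NumberField.RingOfIntegers F₀)).residueCard : ℂ) ^ k) ^ w.asIdeal.inertiaDeg (NumberField.RingOfIntegers F₀))) → ((e.restrictField F).IsOdd ∨ ∀ (φ : F →+* ℝ) (c : Field.absoluteGaloisGroup F), Literature.NumberTheory.GaloisRepresentations.IsComplexConjugation φ c → Matrix.GeneralLinearGroup.det ((e.restrictField F) c) = 1) → (Odd n → (e.restrictField F).IsOdd) → ∀ (ℓ : ℕ) [Fact ℓ.Prime] (ι : PadicAlgCl ℓ ≃+* ℂ), ¬ ((ℓ : ℤ) ∣ NumberField.discr F) → (∀ w : IsDedekindDomain.HeightOneSpectrum (NumberField.RingOfIntegers F), ((ℓ : ℕ) : NumberField.RingOfIntegers F) ∈ w.asIdeal → π.1.IsUnramifiedAt w) → ∀ eψ : Literature.NumberTheory.GaloisRepresentations.FramedGaloisRep F ℂ 1, (∀ w : IsDedekindDomain.HeightOneSpectrum (NumberField.RingOfIntegers F), ((ℓ : ℕ) : NumberField.RingOfIntegers F) ∈ w.asIdeal → eψ.IsUnramifiedAt w) → (∀ (φ : F →+* ℝ) (c c' : Field.absoluteGaloisGroup F), Literature.NumberTheory.GaloisRepresentations.IsComplexConjugation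 φ c → Literature.NumberTheory.GaloisRepresentations.IsComplexConjugation (φ.comp (τ : F →+* F)) c' → Matrix.GeneralLinearGroup.det (eψ c) = Matrix.GeneralLinearGroup.det (eψ c')) → (∃ᶠ w in Filter.cofinite, ∃ (α β : Multiset ℂ) (c c' : ℂ), π.1.HasSatakeParamAt w α ∧ π.1.HasSatakeParamAt (τ • w) β ∧ eψ.HasFrobCharpolyAt w (Polynomial.X - Polynomial.C c) ∧ eψ.HasFrobCharpolyAt (τ • w) (Polynomial.X - Polynomial.C c') ∧ β.map (fun b ↦ b * c') ≠ α.map (fun a ↦ a * c)) → ∃ R : Literature.NumberTheory.GaloisRepresentations.FramedGaloisRep F₀ (PadicAlgCl ℓ) (2 * n), R.toGaloisRep.IsSemisimple ∧ ∀ (v : IsDedekindDomain.HeightOneSpectrum (NumberField.RingOfIntegers F₀)) (α : _ → Multiset ℂ) (c : _ → ℂ), ((ℓ : ℕ) : NumberField.RingOfIntegers F₀) ∉ v.asIdeal → (∀ w : IsDedekindDomain.HeightOneSpectrum (NumberField.RingOfIntegers F), w.under (NumberField.RingOfIntegers F₀) = v → w.asIdeal.ramificationIdx (NumberField.RingOfIntegers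 F₀) = 1 ∧ π.1.HasSatakeParamAt w (α w) ∧ eψ.IsUnramifiedAt w ∧ eψ.HasFrobCharpolyAt w (Polynomial.X - Polynomial.C (c w))) → R.IsUnramifiedAt v ∧ R.HasFrobCharpolyAt v (∏ᶠ w ∈ {w : IsDedekindDomain.HeightOneSpectrum (NumberField.RingOfIntegers F) | w.under (NumberField.RingOfIntegers F₀) = v}, Polynomial.expand (PadicAlgCl ℓ) (w.asIdeal.inertiaDeg (NumberField.RingOfIntegers F₀)) (Literature.NumberTheory.Automorphic.arithFrobPolyOfSatake ι w.residueCard n ((α w).map (fun a ↦ a * c w))))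

/-- The crux with the guard clause `eψ.IsUnramifiedAt w` dropped from the conclusion. -/
def HostInducedRepSlimGuard : Prop :=
  ∀ (F₀ F : Type) [Field F₀] [NumberField F₀] [Field F] [NumberField F] [Algebra F₀ F] (τ : F ≃ₐ[F₀] F), NumberField.IsTotallyReal F₀ → Module.finrank F₀ F = 2 → τ ≠ 1 → ∀ (n : ℕ) (hcpt : Literature.NumberTheory.Automorphic.isCompact_glFiniteIntegralLevel n F) (π : Literature.NumberTheory.Automorphic.CuspidalAutomorphicRepData n F hcpt) (e : Literature.NumberTheory.GaloisRepresentations.FramedGaloisRep F₀ ℂ 1) (k : ℤ), π.1.IsRegularAlgebraic → (∀ᶠ w in Filter.cofinite, ∀ (α β : Multiset ℂ) (c : ℂ), π.1.HasSatakeParamAt w α → π.1.HasSatakeParamAt (τ • w) β → e.HasFrobCharpolyAt (w.under (NumberField.RingOfIntegers F₀)) (Polynomial.X - Polynomial.C c) → β = α.map (fun a ↦ a⁻¹ * (c * ((w.under (NumberField.RingOfIntegers F₀)).residueCard : ℂ) ^ k) ^ w.asIdeal.inertiaDeg (NumberField.RingOfIntegers F₀))) → ((e.restrictField F).IsOdd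 ∨ ∀ (φ : F →+* ℝ) (c : Field.absoluteGaloisGroup F), Literature.NumberTheory.GaloisRepresentations.IsComplexConjugation φ c → Matrix.GeneralLinearGroup.det ((e.restrictField F) c) = 1) → (Odd n → (e.restrictField F).IsOdd) → ∀ (ℓ : ℕ) [Fact ℓ.Prime] (ι : PadicAlgCl ℓ ≃+* ℂ), ¬ ((ℓ : ℤ) ∣ NumberField.discr F) → (∀ w : IsDedekindDomain.HeightOneSpectrum (NumberField.RingOfIntegers F), ((ℓ : ℕ) : NumberField.RingOfIntegers F) ∈ w.asIdeal → π.1.IsUnramifiedAt w) → ∀ eψ : Literature.NumberTheory.GaloisRepresentations.FramedGaloisRep F ℂ 1, (∀ w : IsDedekindDomain.HeightOneSpectrum (NumberField.RingOfIntegers F), ((ℓ : ℕ) : NumberField.RingOfIntegers F) ∈ w.asIdeal → eψ.IsUnramifiedAt w) → (∀ (φ : F →+* ℝ) (c c' : Field.absoluteGaloisGroup F), Literature.NumberTheory.GaloisRepresentations.IsComplexConjugation φ c → Literature.NumberTheory.GaloisRepresentations.IsComplexConjugation (φ.comp (τ : F →+* F)) c' → Matrix.GeneralLinearGroup.det (eψ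 c) = Matrix.GeneralLinearGroup.det (eψ c')) → (∃ᶠ w in Filter.cofinite, ∃ (α β : Multiset ℂ) (c c' : ℂ), π.1.HasSatakeParamAt w α ∧ π.1.HasSatakeParamAt (τ • w) β ∧ eψ.HasFrobCharpolyAt w (Polynomial.X - Polynomial.C c) ∧ eψ.HasFrobCharpolyAt (τ • w) (Polynomial.X - Polynomial.C c') ∧ β.map (fun b ↦ b * c') ≠ α.map (fun a ↦ a * c)) → ∃ R : Literature.NumberTheory.GaloisRepresentations.FramedGaloisRep F₀ (PadicAlgCl ℓ) (2 * n), R.toGaloisRep.IsSemisimple ∧ ∀ (v : IsDedekindDomain.HeightOneSpectrum (NumberField.RingOfIntegers F₀)) (α : _ → Multiset ℂ) (c : _ → ℂ), ((ℓ : ℕ) : NumberField.RingOfIntegers F₀) ∉ v.asIdeal → (∀ w : IsDedekindDomain.HeightOneSpectrum (NumberField.RingOfIntegers F), w.under (NumberField.RingOfIntegers F₀) = v → w.asIdeal.ramificationIdx (NumberField.RingOfIntegers F₀) = 1 ∧ π.1.HasSatakeParamAt w (α w) ∧ eψ.HasFrobCharpolyAt w (Polynomial.X - Polynomial.C (c w)))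 → R.IsUnramifiedAt v ∧ R.HasFrobCharpolyAt v (∏ᶠ w ∈ {w : IsDedekindDomain.HeightOneSpectrum (NumberField.RingOfIntegers F) | w.under (NumberField.RingOfIntegers F₀) = v}, Polynomial.expand (PadicAlgCl ℓ) (w.asIdeal.inertiaDeg (NumberField.RingOfIntegers F₀)) (Literature.NumberTheory.Automorphic.arithFrobPolyOfSatake ι w.residueCard n ((α w).map (fun a ↦ a * c w))))

/-! ## §2 The Frobenius side: uniqueness, degree = rank, rank-one unramifiedness -/

section Frobenius

variable {K : Type} [Field K] [NumberField K] {A : Type*} [CommRing A] [TopologicalSpace A] {m : ℕ}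

/-- Frobenius characteristic polynomials at a place of a number field are unique (a prime above
`v` exists and carries an arithmetic Frobenius: `primesAbove_nonempty`,
`exists_isArithFrobAt_of_mem_primesAbove_holds`).  Local copy of the accepted fact
`FramedGaloisRep.HasFrobCharpolyAt.unique`. -/
theorem hasFrobCharpolyAt_unique' {v : HeightOneSpectrum (𝓞 K)} {ρ : FramedGaloisRep K A m}
    {P Q : A[X]} (hP : ρ.HasFrobCharpolyAt v P) (hQ : ρ.HasFrobCharpolyAt v Q) : P = Q := by
  obtain ⟨𝔓, h𝔓⟩ := v.primesAbove_nonempty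
  obtain ⟨σ, hσ⟩ := HeightOneSpectrum.exists_isArithFrobAt_of_mem_primesAbove_holds h𝔓
  rw [← hP 𝔓 h𝔓 σ hσ, ← hQ 𝔓 h𝔓 σ hσ]

/-- **Degree = rank.**  A Frobenius characteristic polynomial of a rank-`m` framed representation
over a nontrivial ring has `natDegree = m` (Mathlib `Matrix.charpoly_natDegree_eq_dim`). -/
theorem natDegree_eq_rank_of_hasFrobCharpolyAt [Nontrivial A] {v : HeightOneSpectrum (𝓞 K)}
    {ρ : FramedGaloisRep K A m} {P : A[X]} (hP : ρ.HasFrobCharpolyAt v P) : P.natDegree = m := by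
  obtain ⟨𝔓, h𝔓⟩ := v.primesAbove_nonempty
  obtain ⟨σ, hσ⟩ := HeightOneSpectrum.exists_isArithFrobAt_of_mem_primesAbove_holds h𝔓
  rw [← hP 𝔓 h𝔓 σ hσ, FramedRep.charpoly, Matrix.charpoly_natDegree_eq_dim, Fintype.card_fin]

/-- **Rank obstruction** (gen-1 §4 re-derived): a polynomial whose degree is not the rank is the
Frobenius characteristic polynomial of NO representation of that rank.  Applied to the conclusion
of the crux: the finprod `∏_{w ∣ v} P_w(X^{f(w∣v)})` has degree `n · ∑_{w∣v} f(w∣v)` (§3), which is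
`2n` exactly when `∑ f = 2 = [F : F₀]`, i.e. when `v` is unramified in the quadratic `F`; drop
`finrank F₀ F = 2` (say `[F:F₀] = 3`) or the guard `ramificationIdx = 1` (ramified `v`: `∑ f = 1`)
and the conclusion becomes unsatisfiable at such `v` for every `R`, for every `π` meeting the
hypotheses — both are load-bearing. -/
theorem not_hasFrobCharpolyAt_of_natDegree_ne [Nontrivial A] {v : HeightOneSpectrum (𝓞 K)}
    (ρ : FramedGaloisRep K A m) {P : A[X]} (hP : P.natDegree ≠ m) : ¬ ρ.HasFrobCharpolyAt v P :=
  fun h ↦ hP (natDegree_eq_rank_of_hasFrobCharpolyAt h)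

omit [NumberField K] in
/-- In rank one the characteristic polynomial is `X - C (the entry)`. -/
theorem charpoly_rankOne (ρ : FramedGaloisRep K A 1) (σ : Field.absoluteGaloisGroup K) :
    FramedRep.charpoly ρ σ = X - C (((ρ σ : GL (Fin 1) A) : Matrix (Fin 1) (Fin 1) A) 0 0) := by
  rw [FramedRep.charpoly, Matrix.charpoly, Matrix.det_fin_one, Matrix.charmatrix_apply_eq]

omit [NumberField K] in
/-- A rank-one framed representation is determined at `σ` by its characteristic polynomial. -/
theorem eq_of_charpoly_eq_rankOne (ρ : FramedGaloisRep K A 1) {σ σ' : Field.absoluteGaloisGroup K}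
    (h : FramedRep.charpoly ρ σ = FramedRep.charpoly ρ σ') : ρ σ = ρ σ' := by
  rw [charpoly_rankOne, charpoly_rankOne, sub_right_inj, C_inj] at h
  refine Units.ext (Matrix.ext fun i j ↦ ?_)
  rw [Subsingleton.elim i 0, Subsingleton.elim j 0]
  exact h

/-- **NEW (gen-3): in rank one the Frobenius clause forces unramifiedness.**  If every arithmetic
Frobenius at every `𝔓 ∣ w` has the same characteristic polynomial `P` (which is what
`eψ.HasFrobCharpolyAt w P` says), then `eψ` kills every inertia group above `w`: for `τ ∈ I_𝔓` and
a Frobenius `σ` at `𝔓`, `τσ` is again a Frobenius (`isArithFrobAt_mul_iff_of_mem_inertia`), so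
`eψ(τσ) = eψ(σ)` in `GL₁`.  Hence in the crux the guard clause `eψ.IsUnramifiedAt w` (and `hψunr`
at places carrying a Frobenius clause) is implied by `eψ.HasFrobCharpolyAt w (X - C (c w))`.
(False in rank `≥ 2`, see the docstring of `GaloisRep.HasFrobCharpolyAt`.) -/
theorem isUnramifiedAt_of_hasFrobCharpolyAt_rankOne {w : HeightOneSpectrum (𝓞 K)}
    (ρ : FramedGaloisRep K A 1) {P : A[X]} (hP : ρ.HasFrobCharpolyAt w P) : ρ.IsUnramifiedAt w := by
  intro 𝔓 h𝔓 τ hτ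
  obtain ⟨σ, hσ⟩ := HeightOneSpectrum.exists_isArithFrobAt_of_mem_primesAbove_holds h𝔓
  have hτσ : IsArithFrobAt (𝓞 K) (τ * σ) 𝔓 := (isArithFrobAt_mul_iff_of_mem_inertia hτ).mpr hσ
  have h1 : ρ (τ * σ) = ρ σ :=
    eq_of_charpoly_eq_rankOne ρ ((hP 𝔓 h𝔓 _ hτσ).trans (hP 𝔓 h𝔓 σ hσ).symm)
  rwa [map_mul, mul_eq_right] at h1

/-- The value read off by a rank-one Frobenius clause `ρ.HasFrobCharpolyAt w (X - C c)` is a unit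
(it is the entry of an invertible `1 × 1` matrix), in particular `c ≠ 0` over a nontrivial ring. -/
theorem isUnit_of_hasFrobCharpolyAt_X_sub_C {w : HeightOneSpectrum (𝓞 K)} (ρ : FramedGaloisRep K A 1)
    {c : A} (h : ρ.HasFrobCharpolyAt w (X - C c)) : IsUnit c := by
  obtain ⟨𝔓, h𝔓⟩ := w.primesAbove_nonempty
  obtain ⟨σ, hσ⟩ := HeightOneSpectrum.exists_isArithFrobAt_of_mem_primesAbove_holds h𝔓
  have hc := h 𝔓 h𝔓 σ hσ
  rw [charpoly_rankOne, sub_right_inj, C_inj] at hc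
  rw [← hc]
  have hdet : IsUnit ((ρ σ : GL (Fin 1) A) : Matrix (Fin 1) (Fin 1) A).det :=
    Matrix.isUnits_det_units _
  rwa [Matrix.det_fin_one] at hdet

end Frobenius


/-! ### The two redundancy equivalences (R1), (R2) of §1b -/

section Redundancy

/-- **(R1) `τ ≠ 1` is redundant**: the crux without it is equivalent to the crux.  At `τ = 1`
the hypothesis `∃ᶠ w, … β.map (· * c') ≠ α.map (· * c)` fails: `α = β` by uniqueness of Satake
parameters (`hasSatakeParamAt_unique_holds`) and `c = c'` by uniqueness of Frobenius
characteristic polynomials (`hasFrobCharpolyAt_unique'`). -/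
theorem hostInducedRepWithoutTau_iff : HostInducedRepWithoutTau ↔ HostInducedRep := by
  refine ⟨fun h F₀ F _ _ _ _ _ τ hTR hdeg _ ↦ h F₀ F τ hTR hdeg, fun h F₀ F _ _ _ _ _ τ hTR hdeg ↦ ?_⟩
  by_cases hτ : τ = 1
  · subst hτ
    intro n hcpt π e k _ _ _ _ ℓ _ ι _ _ eψ _ _ hnti
    exfalso
    obtain ⟨w, α, β, c, c', hα, hβ, hc, hc', hne⟩ := hnti.exists
    rw [one_smul] at hβ hc'
    have hαβ : α = β := AutomorphicRepData.hasSatakeParamAt_unique_holds π.1 hα hβ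
    have hcc : c = c' := by
      have := hasFrobCharpolyAt_unique' hc hc'
      rwa [sub_right_inj, C_inj] at this
    exact hne (by rw [hαβ, hcc])
  · exact h F₀ F τ hTR hdeg hτ

/-- **(R2) the guard clause `eψ.IsUnramifiedAt w` is redundant**: the crux with the slimmer guard
is equivalent to the crux (`isUnramifiedAt_of_hasFrobCharpolyAt_rankOne`). -/
theorem hostInducedRepSlimGuard_iff : HostInducedRepSlimGuard ↔ HostInducedRep := by
  constructor
  · intro h F₀ F _ _ _ _ _ τ hTR hdeg hτ n hcpt π e k hreg hpol hpar hodd ℓ _ ι hℓ hunr eψ hψunr hψpar hψnti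
    obtain ⟨R, hss, hR⟩ :=
      h F₀ F τ hTR hdeg hτ n hcpt π e k hreg hpol hpar hodd ℓ ι hℓ hunr eψ hψunr hψpar hψnti
    exact ⟨R, hss, fun v α c hv hg ↦ hR v α c hv fun w hw ↦
      ⟨(hg w hw).1, (hg w hw).2.1, (hg w hw).2.2.2⟩⟩
  · intro h F₀ F _ _ _ _ _ τ hTR hdeg hτ n hcpt π e k hreg hpol hpar hodd ℓ _ ι hℓ hunr eψ hψunr hψpar hψnti
    obtain ⟨R, hss, hR⟩ :=
      h F₀ F τ hTR hdeg hτ n hcpt π e k hreg hpol hpar hodd ℓ ι hℓ hunr eψ hψunr hψpar hψnti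
    exact ⟨R, hss, fun v α c hv hg ↦ hR v α c hv fun w hw ↦
      ⟨(hg w hw).1, (hg w hw).2.1, isUnramifiedAt_of_hasFrobCharpolyAt_rankOne eψ (hg w hw).2.2,
        (hg w hw).2.2⟩⟩

end Redundancy

/-! ## §3 Fibre bookkeeping: the finprod of the conclusion is a finite product of degree `n · ∑ f` -/

section Fibre

variable {F₀ F : Type} [Field F₀] [NumberField F₀] [Field F] [NumberField F] [Algebra F₀ F]

/-- The fibre of a place `v` of `F₀` in `F` (the index set of the finprod in the conclusion). -/
def fibre (F) [Field F] [NumberField F] [Algebra F₀ F] (v : HeightOneSpectrum (𝓞 F₀)) :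
    Set (HeightOneSpectrum (𝓞 F)) :=
  {w | w.under (𝓞 F₀) = v}

omit [NumberField F₀] in
theorem mem_fibre {v : HeightOneSpectrum (𝓞 F₀)} {w : HeightOneSpectrum (𝓞 F)} :
    w ∈ fibre F v ↔ w.under (𝓞 F₀) = v := Iff.rfl

/-- The fibre is finite (Mathlib `primesOver_finite`; `w ↦ w.asIdeal` is injective). -/
theorem finite_fibre (v : HeightOneSpectrum (𝓞 F₀)) : (fibre F v).Finite := by
  have hfin := IsDedekindDomain.primesOver_finite v.asIdeal (𝓞 F)
  refine (hfin.preimage (f := fun w : HeightOneSpectrum (𝓞 F) ↦ w.asIdeal)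
    (fun w _ w' _ h ↦ HeightOneSpectrum.ext h)).subset fun w hw ↦ ?_
  refine ⟨w.isPrime, ⟨?_⟩⟩
  rw [mem_fibre] at hw
  rw [← hw, HeightOneSpectrum.under_asIdeal]

/-- The fibre is nonempty (a prime of `𝓞 F` lies over every prime of `𝓞 F₀`). -/
theorem fibre_nonempty (v : HeightOneSpectrum (𝓞 F₀)) : (fibre F v).Nonempty := by
  obtain ⟨P, hPmax, hP⟩ :=
    Ideal.exists_maximal_ideal_liesOver_of_isIntegral (S := 𝓞 F) v.asIdeal
  refine ⟨⟨P, hPmax.isPrime, ?_⟩, ?_⟩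
  · intro hbot
    apply v.ne_bot
    rw [hP.over, hbot, Ideal.under_bot]
  · change HeightOneSpectrum.under (𝓞 F₀) _ = v
    exact HeightOneSpectrum.ext hP.over.symm

/-- Residue degrees in the fibre are positive. -/
theorem inertiaDeg_pos (w : HeightOneSpectrum (𝓞 F)) : 0 < w.asIdeal.inertiaDeg (𝓞 F₀) :=
  Ideal.inertiaDeg_pos _ _

variable {ℓ : ℕ} [Fact ℓ.Prime]

/-- The factor of the host polynomial at `w`: `P_w(X^{f(w∣v)})`, `P_w = arithFrobPolyOfSatake` of
the twisted parameter `α_w · c_w` (verbatim sub-term of the crux). -/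
def hostFactor (ι : PadicAlgCl ℓ ≃+* ℂ) (n : ℕ) (α : HeightOneSpectrum (𝓞 F) → Multiset ℂ)
    (c : HeightOneSpectrum (𝓞 F) → ℂ) (w : HeightOneSpectrum (𝓞 F)) : (PadicAlgCl ℓ)[X] :=
  Polynomial.expand (PadicAlgCl ℓ) (w.asIdeal.inertiaDeg (𝓞 F₀))
    (arithFrobPolyOfSatake ι w.residueCard n ((α w).map (fun a ↦ a * c w)))

/-- The host polynomial at `v` (verbatim: the finprod of the crux's conclusion). -/
def hostPoly (ι : PadicAlgCl ℓ ≃+* ℂ) (n : ℕ) (α : HeightOneSpectrum (𝓞 F) → Multiset ℂ)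
    (c : HeightOneSpectrum (𝓞 F) → ℂ) (v : HeightOneSpectrum (𝓞 F₀)) : (PadicAlgCl ℓ)[X] :=
  ∏ᶠ w ∈ {w : HeightOneSpectrum (𝓞 F) | w.under (𝓞 F₀) = v}, hostFactor (F₀ := F₀) ι n α c w

/-- Each factor is monic (a product of `X - C _`, expanded by a positive exponent). -/
theorem monic_hostFactor (ι : PadicAlgCl ℓ ≃+* ℂ) (n : ℕ) (α : HeightOneSpectrum (𝓞 F) → Multiset ℂ)
    (c : HeightOneSpectrum (𝓞 F) → ℂ) (w : HeightOneSpectrum (𝓞 F)) :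
    (hostFactor (F₀ := F₀) ι n α c w).Monic := by
  refine Polynomial.Monic.expand (inertiaDeg_pos (F₀ := F₀) w) ?_
  unfold arithFrobPolyOfSatake
  exact monic_multiset_prod_of_monic _ _ fun a _ ↦ monic_X_sub_C _

omit [NumberField F₀] in
/-- Each factor has degree `f(w∣v) · card α_w`. -/
theorem natDegree_hostFactor (ι : PadicAlgCl ℓ ≃+* ℂ) (n : ℕ)
    (α : HeightOneSpectrum (𝓞 F) → Multiset ℂ) (c : HeightOneSpectrum (𝓞 F) → ℂ)
    (w : HeightOneSpectrum (𝓞 F)) :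
    (hostFactor (F₀ := F₀) ι n α c w).natDegree =
      Multiset.card (α w) * w.asIdeal.inertiaDeg (𝓞 F₀) := by
  rw [hostFactor, natDegree_expand, natDegree_arithFrobPolyOfSatake, Multiset.card_map]

/-- The finprod is an honest finite product over the fibre. -/
theorem hostPoly_eq_prod (ι : PadicAlgCl ℓ ≃+* ℂ) (n : ℕ) (α : HeightOneSpectrum (𝓞 F) → Multiset ℂ)
    (c : HeightOneSpectrum (𝓞 F) → ℂ) (v : HeightOneSpectrum (𝓞 F₀)) :
    hostPoly ι n α c v = ∏ w ∈ (finite_fibre (F := F) v).toFinset, hostFactor (F₀ := F₀) ι n α c w :=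
  finprod_mem_eq_finite_toFinset_prod _ (finite_fibre v)

/-- The host polynomial is monic, in particular non-zero. -/
theorem monic_hostPoly (ι : PadicAlgCl ℓ ≃+* ℂ) (n : ℕ) (α : HeightOneSpectrum (𝓞 F) → Multiset ℂ)
    (c : HeightOneSpectrum (𝓞 F) → ℂ) (v : HeightOneSpectrum (𝓞 F₀)) : (hostPoly ι n α c v).Monic := by
  rw [hostPoly_eq_prod]
  exact monic_prod_of_monic _ _ fun w _ ↦ monic_hostFactor ι n α c w

/-- **Degree of the host polynomial** `= ∑_{w ∣ v} card(α_w) · f(w∣v)`; with Satake parameters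
(`card α_w = n`) this is `n · ∑_{w∣v} f(w∣v)`, i.e. `n · [F:F₀]` at an unramified `v` and
`< n · [F:F₀]` at a ramified one (fundamental identity `∑ e f = [F:F₀]`).  Combined with
`natDegree_eq_rank_of_hasFrobCharpolyAt` (the rank of `R` is `2n`) this is the rank obstruction. -/
theorem natDegree_hostPoly (ι : PadicAlgCl ℓ ≃+* ℂ) (n : ℕ) (α : HeightOneSpectrum (𝓞 F) → Multiset ℂ)
    (c : HeightOneSpectrum (𝓞 F) → ℂ) (v : HeightOneSpectrum (𝓞 F₀)) :
    (hostPoly ι n α c v).natDegree =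
      ∑ w ∈ (finite_fibre (F := F) v).toFinset, Multiset.card (α w) * w.asIdeal.inertiaDeg (𝓞 F₀) := by
  rw [hostPoly_eq_prod, natDegree_prod_of_monic _ _ fun w _ ↦ monic_hostFactor ι n α c w]
  exact Finset.sum_congr rfl fun w _ ↦ natDegree_hostFactor ι n α c w

/-- With genuine Satake parameters on the fibre the degree is `n · ∑_{w∣v} f(w∣v)`. -/
theorem natDegree_hostPoly_of_card_eq (ι : PadicAlgCl ℓ ≃+* ℂ) (n : ℕ)
    (α : HeightOneSpectrum (𝓞 F) → Multiset ℂ) (c : HeightOneSpectrum (𝓞 F) → ℂ)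
    (v : HeightOneSpectrum (𝓞 F₀)) (hcard : ∀ w ∈ fibre F v, Multiset.card (α w) = n) :
    (hostPoly ι n α c v).natDegree =
      n * ∑ w ∈ (finite_fibre (F := F) v).toFinset, w.asIdeal.inertiaDeg (𝓞 F₀) := by
  rw [natDegree_hostPoly, Finset.mul_sum]
  exact Finset.sum_congr rfl fun w hw ↦ by rw [hcard w ((finite_fibre v).mem_toFinset.mp hw)]

end Fibre

/-! ## §3b The quadratic fibre: `Gal(F/F₀) = {1, τ}`, fibre `= {w, τ • w}`, `∑ f = 2`,
and the two shapes of the host polynomial (gen-1 §7 re-derived) -/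

section Quadratic

open scoped Classical

variable {F₀ F : Type} [Field F₀] [NumberField F₀] [Field F] [NumberField F] [Algebra F₀ F]

/-- A quadratic extension of number fields is Galois (Mathlib `Algebra.IsQuadraticExtension`). -/
theorem isGalois_of_finrank_eq_two (hdeg : Module.finrank F₀ F = 2) : IsGalois F₀ F :=
  haveI : Algebra.IsQuadraticExtension F₀ F := ⟨hdeg⟩
  inferInstance

/-- … so its automorphism group has exactly two elements. -/
theorem card_aut_eq_two (hdeg : Module.finrank F₀ F = 2) : Fintype.card (F ≃ₐ[F₀] F) = 2 := by
  haveI := isGalois_of_finrank_eq_two hdeg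
  rw [Fintype.card_eq_nat_card, IsGalois.card_aut_eq_finrank, hdeg]

/-- `Gal(F/F₀) = {1, τ}` for any `τ ≠ 1`. -/
theorem aut_eq_one_or_eq (hdeg : Module.finrank F₀ F = 2) {τ : F ≃ₐ[F₀] F} (hτ : τ ≠ 1)
    (σ : F ≃ₐ[F₀] F) : σ = 1 ∨ σ = τ := by
  by_contra h
  push Not at h
  have h3 : ({1, τ, σ} : Finset (F ≃ₐ[F₀] F)).card = 3 := by
    rw [Finset.card_insert_of_notMem (by simp [hτ.symm, h.1.symm]),
      Finset.card_insert_of_notMem (by simp [h.2.symm]), Finset.card_singleton]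
  have := Finset.card_le_univ ({1, τ, σ} : Finset (F ≃ₐ[F₀] F))
  rw [h3, card_aut_eq_two hdeg] at this
  omega

omit [NumberField F₀] in
/-- The fibre in the tree's `asIdeal` form (used by `finsum_inertiaDeg_eq_finrank`). -/
theorem fibre_eq_setOf_asIdeal (v : HeightOneSpectrum (𝓞 F₀)) :
    fibre F v = {w : HeightOneSpectrum (𝓞 F) | w.asIdeal.under (𝓞 F₀) = v.asIdeal} := by
  ext w
  rw [mem_fibre, Set.mem_setOf_eq, HeightOneSpectrum.ext_iff, HeightOneSpectrum.under_asIdeal]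

/-- `τ • w` lies in the same fibre. -/
theorem smul_mem_fibre (τ : F ≃ₐ[F₀] F) {v : HeightOneSpectrum (𝓞 F₀)} {w : HeightOneSpectrum (𝓞 F)}
    (hw : w ∈ fibre F v) : τ • w ∈ fibre F v := by
  rw [mem_fibre] at hw ⊢
  rw [← hw]
  exact HeightOneSpectrum.under_algEquiv_smul F₀ F τ w

/-- **The fibre of `v` is `{w, τ • w}`** (transitivity of `Gal(F/F₀) = {1, τ}` on the fibre). -/
theorem fibre_eq_pair (hdeg : Module.finrank F₀ F = 2) {τ : F ≃ₐ[F₀] F} (hτ : τ ≠ 1)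
    {v : HeightOneSpectrum (𝓞 F₀)} {w : HeightOneSpectrum (𝓞 F)} (hw : w ∈ fibre F v) :
    fibre F v = {w, τ • w} := by
  haveI := isGalois_of_finrank_eq_two hdeg
  refine Set.Subset.antisymm (fun w' hw' ↦ ?_) ?_
  · obtain ⟨σ, rfl⟩ := HeightOneSpectrum.exists_algEquiv_smul_eq F₀
      ((mem_fibre.mp hw).trans (mem_fibre.mp hw').symm)
    rcases aut_eq_one_or_eq hdeg hτ σ with rfl | rfl
    · exact Or.inl (one_smul _ _)
    · exact Or.inr rfl
  · rintro w' (rfl | rfl)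
    exacts [hw, smul_mem_fibre τ hw]

/-- **`∑_{w ∣ v} f(w∣v) = 2` at a place unramified in the quadratic `F`** (fundamental identity,
tree `finsum_inertiaDeg_eq_finrank`, with the guard `e(w∣v) = 1` on the fibre). -/
theorem sum_inertiaDeg_eq_two (hdeg : Module.finrank F₀ F = 2) {v : HeightOneSpectrum (𝓞 F₀)}
    (hunr : ∀ w ∈ fibre F v, w.asIdeal.ramificationIdx (𝓞 F₀) = 1) :
    ∑ w ∈ (finite_fibre (F := F) v).toFinset, w.asIdeal.inertiaDeg (𝓞 F₀) = 2 := by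
  have hv : Algebra.IsUnramifiedIn (𝓞 F) v.asIdeal := by
    rw [Algebra.isUnramifiedIn_iff_forall_ramificationIdx_eq_one]
    intro 𝔓 _ h𝔓
    have hne : 𝔓 ≠ ⊥ := Ideal.ne_bot_of_liesOver_of_ne_bot v.ne_bot 𝔓
    exact hunr ⟨𝔓, inferInstance, hne⟩ (mem_fibre.mpr (HeightOneSpectrum.ext h𝔓.over.symm))
  have h := finsum_inertiaDeg_eq_finrank (E := F) v hv
  rw [← fibre_eq_setOf_asIdeal, finsum_mem_eq_finite_toFinset_sum _ (finite_fibre v), hdeg] at h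
  exact h

variable {ℓ : ℕ} [Fact ℓ.Prime]

/-- **Degree `2n` under the guard** — the conclusion is dimensionally consistent with a rank-`2n`
representation exactly because `[F:F₀] = 2` and `v` is unramified (cf. §2 rank obstruction). -/
theorem natDegree_hostPoly_eq_two_mul (hdeg : Module.finrank F₀ F = 2) (ι : PadicAlgCl ℓ ≃+* ℂ)
    (n : ℕ) (α : HeightOneSpectrum (𝓞 F) → Multiset ℂ) (c : HeightOneSpectrum (𝓞 F) → ℂ)
    {v : HeightOneSpectrum (𝓞 F₀)} (hcard : ∀ w ∈ fibre F v, Multiset.card (α w) = n)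
    (hunr : ∀ w ∈ fibre F v, w.asIdeal.ramificationIdx (𝓞 F₀) = 1) :
    (hostPoly ι n α c v).natDegree = 2 * n := by
  rw [natDegree_hostPoly_of_card_eq ι n α c v hcard, sum_inertiaDeg_eq_two hdeg hunr, mul_comm]

/-- **Inert `v`** (`τ • w = w`): the fibre is `{w}` and `f(w∣v) = 2`. -/
theorem inertiaDeg_eq_two_of_smul_eq (hdeg : Module.finrank F₀ F = 2) {τ : F ≃ₐ[F₀] F} (hτ : τ ≠ 1)
    {v : HeightOneSpectrum (𝓞 F₀)} {w : HeightOneSpectrum (𝓞 F)} (hw : w ∈ fibre F v)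
    (hfix : τ • w = w) (hunr : ∀ w ∈ fibre F v, w.asIdeal.ramificationIdx (𝓞 F₀) = 1) :
    w.asIdeal.inertiaDeg (𝓞 F₀) = 2 := by
  have h := sum_inertiaDeg_eq_two hdeg hunr
  have hset : (finite_fibre (F := F) v).toFinset = {w} := by
    rw [← Finset.coe_inj, Set.Finite.coe_toFinset, fibre_eq_pair hdeg hτ hw, hfix, Set.pair_eq_singleton,
      Finset.coe_singleton]
  rwa [hset, Finset.sum_singleton] at h

/-- **Split `v`** (`τ • w ≠ w`): `f(w∣v) = 1` (and symmetrically `f(τw∣v) = 1`). -/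
theorem inertiaDeg_eq_one_of_smul_ne (hdeg : Module.finrank F₀ F = 2) {τ : F ≃ₐ[F₀] F} (hτ : τ ≠ 1)
    {v : HeightOneSpectrum (𝓞 F₀)} {w : HeightOneSpectrum (𝓞 F)} (hw : w ∈ fibre F v)
    (hsplit : τ • w ≠ w) (hunr : ∀ w ∈ fibre F v, w.asIdeal.ramificationIdx (𝓞 F₀) = 1) :
    w.asIdeal.inertiaDeg (𝓞 F₀) = 1 := by
  have h := sum_inertiaDeg_eq_two hdeg hunr
  have hset : (finite_fibre (F := F) v).toFinset = {w, τ • w} := by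
    rw [← Finset.coe_inj, Set.Finite.coe_toFinset, fibre_eq_pair hdeg hτ hw, Finset.coe_insert,
      Finset.coe_singleton]
  rw [hset, Finset.sum_insert (by simpa using hsplit.symm), Finset.sum_singleton,
    HeightOneSpectrum.inertiaDeg_algEquiv_smul] at h
  have hpos := inertiaDeg_pos (F₀ := F₀) w
  omega

/-- **Host polynomial at an inert place: `P_w(X²)`** (one factor, `expand 2`). -/
theorem hostPoly_of_smul_eq (hdeg : Module.finrank F₀ F = 2) {τ : F ≃ₐ[F₀] F} (hτ : τ ≠ 1)
    (ι : PadicAlgCl ℓ ≃+* ℂ) (n : ℕ) (α : HeightOneSpectrum (𝓞 F) → Multiset ℂ)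
    (c : HeightOneSpectrum (𝓞 F) → ℂ) {v : HeightOneSpectrum (𝓞 F₀)} {w : HeightOneSpectrum (𝓞 F)}
    (hw : w ∈ fibre F v) (hfix : τ • w = w) (hunr : ∀ w ∈ fibre F v, w.asIdeal.ramificationIdx (𝓞 F₀) = 1) :
    hostPoly ι n α c v =
      expand (PadicAlgCl ℓ) 2 (arithFrobPolyOfSatake ι w.residueCard n ((α w).map (fun a ↦ a * c w))) := by
  have hset : (finite_fibre (F := F) v).toFinset = {w} := by
    rw [← Finset.coe_inj, Set.Finite.coe_toFinset, fibre_eq_pair hdeg hτ hw, hfix, Set.pair_eq_singleton,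
      Finset.coe_singleton]
  rw [hostPoly_eq_prod, hset, Finset.prod_singleton, hostFactor, inertiaDeg_eq_two_of_smul_eq hdeg hτ hw hfix hunr]

/-- **Host polynomial at a split place: `P_w · P_{τw}`** (two factors, `expand 1 = id`). -/
theorem hostPoly_of_smul_ne (hdeg : Module.finrank F₀ F = 2) {τ : F ≃ₐ[F₀] F} (hτ : τ ≠ 1)
    (ι : PadicAlgCl ℓ ≃+* ℂ) (n : ℕ) (α : HeightOneSpectrum (𝓞 F) → Multiset ℂ)
    (c : HeightOneSpectrum (𝓞 F) → ℂ) {v : HeightOneSpectrum (𝓞 F₀)} {w : HeightOneSpectrum (𝓞 F)}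
    (hw : w ∈ fibre F v) (hsplit : τ • w ≠ w) (hunr : ∀ w ∈ fibre F v, w.asIdeal.ramificationIdx (𝓞 F₀) = 1) :
    hostPoly ι n α c v =
      arithFrobPolyOfSatake ι w.residueCard n ((α w).map (fun a ↦ a * c w)) *
        arithFrobPolyOfSatake ι (τ • w).residueCard n ((α (τ • w)).map (fun a ↦ a * c (τ • w))) := by
  have hset : (finite_fibre (F := F) v).toFinset = {w, τ • w} := by
    rw [← Finset.coe_inj, Set.Finite.coe_toFinset, fibre_eq_pair hdeg hτ hw, Finset.coe_insert,
      Finset.coe_singleton]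
  have h1 := inertiaDeg_eq_one_of_smul_ne hdeg hτ hw hsplit hunr
  have h2 : (τ • w).asIdeal.inertiaDeg (𝓞 F₀) = 1 := by
    rw [HeightOneSpectrum.inertiaDeg_algEquiv_smul]; exact h1
  rw [hostPoly_eq_prod, hset, Finset.prod_insert (by simpa using hsplit.symm), Finset.prod_singleton,
    hostFactor, hostFactor, h1, h2, expand_one, expand_one]

end Quadratic

/-! ## §4 NEW (gen-3): the two matrix identities behind `∏_{w ∣ v} P_w(X^{f(w∣v)})`

For the intended witness `R = Ind_{Γ_F}^{Γ_{F₀}} r` (`r = ρ_π ⊗ ẽψ⁻¹`): at a split `v` an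
arithmetic Frobenius `σ ∈ Γ_F` acts block-diagonally by `r(Frob_w) ⊕ r(Frob_{τw})`
(`Matrix.charpoly_fromBlocks_zero₁₂`: `charpoly = P_w · P_{τw}`); at an inert `v` it acts, in the
basis `(e, σ e)`, by the block matrix `[[0, A], [1, 0]]` with `A = r(σ²) = r(Frob_w)`, and
`charpoly [[0, A], [1, 0]] = (charpoly A)(X²) = P_w(X^2)`.  The second identity is not in Mathlib;
here it is over any commutative ring. -/

section Blocks

variable {R : Type*} [CommRing R] {m : Type*} [Fintype m] [DecidableEq m]

/-- The block swap `inl a ↔ inr a` of `m ⊕ m` has sign `(-1)^{|m|}` (copy of the folklore lemma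
`Literature.AlgebraicGeometry.Motives.val_sign_sumComm_self`, kept local to spare the import). -/
theorem val_sign_sumComm_self :
    ((Equiv.Perm.sign (Equiv.sumComm m m) : ℤˣ) : ℤ) = (-1) ^ Fintype.card m := by
  let e : m × Bool ≃ m ⊕ m :=
    { toFun := fun p => bif p.2 then Sum.inr p.1 else Sum.inl p.1
      invFun := Sum.elim (fun a => (a, false)) (fun a => (a, true))
      left_inv := by rintro ⟨a, _ | _⟩ <;> rfl
      right_inv := by rintro (a | a) <;> rfl }
  have h : Equiv.sumComm m m =
      (e.symm.trans (Equiv.prodCongrRight fun _ : m => Equiv.swap false true)).trans e :=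
    Equiv.ext fun x => by
      rcases x with a | a
      · show Sum.inr a = e (a, Equiv.swap false true false)
        rw [Equiv.swap_apply_left]
        rfl
      · show Sum.inl a = e (a, Equiv.swap false true true)
        rw [Equiv.swap_apply_right]
        rfl
  rw [h, Equiv.Perm.sign_symm_trans_trans, Equiv.Perm.sign_prodCongrRight, Units.coe_prod]
  simp only [Equiv.Perm.sign_swap (by decide : (false : Bool) ≠ true), Units.val_neg,
    Units.val_one, Finset.prod_const, Finset.card_univ]

/-- `det [[A, B], [C, 0]] = (-1)^{|m|} · det B · det C` for square blocks of one size. -/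
theorem det_fromBlocks_zero₂₂_eq (A B C : Matrix m m R) :
    (Matrix.fromBlocks A B C (0 : Matrix m m R)).det = (-1) ^ Fintype.card m * (B.det * C.det) := by
  have h : Matrix.fromBlocks A B C (0 : Matrix m m R) =
      (Matrix.fromBlocks B A 0 C).submatrix id (Equiv.sumComm m m) := by
    ext (i | i) (j | j) <;> rfl
  rw [h, Matrix.det_permute', Matrix.det_fromBlocks_zero₂₁, val_sign_sumComm_self, Int.cast_pow,
    Int.cast_neg, Int.cast_one]

/-- **`charpoly [[0, A], [1, 0]] = (charpoly A)(X²)`** — the characteristic polynomial of an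
induced Frobenius at an inert place (`det(X - Ind σ) = det(X² - r(σ²))`).  Proof: right-multiply
the characteristic matrix `[[X, -A], [-1, X]]` by the unipotent `[[1, X], [0, 1]]` to get
`[[X, X² - A], [-1, 0]]`, whose determinant is `det(X² - A)` by `det_fromBlocks_zero₂₂_eq`, and
`det(X² - A) = expand 2 (charpoly A)` (`AlgHom.map_det` for `expand`). -/
theorem charpoly_fromBlocks_zero_one (A : Matrix m m R) :
    (Matrix.fromBlocks 0 A 1 0).charpoly = expand R 2 A.charpoly := by
  have hcm : (Matrix.fromBlocks 0 A 1 0).charmatrix =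
      Matrix.fromBlocks (Matrix.scalar m (X : R[X])) (-A.map C) (-1) (Matrix.scalar m (X : R[X])) := by
    ext (i | i) (j | j)
    · by_cases h : i = j
      · subst h; simp [Matrix.charmatrix_apply_eq]
      · simp [h]
    · simp [Matrix.charmatrix_apply_ne]
    · by_cases h : i = j
      · subst h; simp [Matrix.charmatrix_apply_ne]
      · simp [h]
    · by_cases h : i = j
      · subst h; simp [Matrix.charmatrix_apply_eq]
      · simp [h]
  set Xs : Matrix m m R[X] := Matrix.scalar m (X : R[X]) with hXs
  have hU : (Matrix.fromBlocks (1 : Matrix m m R[X]) Xs 0 1).det = 1 := by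
    rw [Matrix.det_fromBlocks_zero₂₁, Matrix.det_one, mul_one]
  have hprod : Matrix.fromBlocks Xs (-A.map C) (-1) Xs * Matrix.fromBlocks 1 Xs 0 1 =
      Matrix.fromBlocks Xs (Xs * Xs - A.map C) (-1) 0 := by
    rw [Matrix.fromBlocks_multiply]
    congr 1
    · simp
    · rw [Matrix.mul_one, sub_eq_add_neg]
    · simp
    · rw [Matrix.neg_mul, Matrix.one_mul, Matrix.mul_one, neg_add_cancel]
  have hdet := congrArg Matrix.det hprod
  rw [Matrix.det_mul, hU, mul_one, det_fromBlocks_zero₂₂_eq, Matrix.det_neg, Matrix.det_one,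
    mul_one, ← mul_assoc, mul_right_comm, ← mul_pow, neg_mul_neg, one_mul, one_pow, one_mul] at hdet
  rw [Matrix.charpoly, hcm, hdet]
  have hexp : expand R 2 A.charpoly =
      ((expand R 2 : R[X] →ₐ[R] R[X]).mapMatrix A.charmatrix).det := by
    rw [Matrix.charpoly, AlgHom.map_det]
  rw [hexp]
  congr 1
  ext i j
  by_cases h : i = j
  · subst h
    simp [Matrix.charmatrix_apply_eq, hXs, Matrix.sub_apply, sq]
  · simp [hXs, Matrix.sub_apply, h]

/-- The split-place identity, for the record (Mathlib): block-diagonal Frobenius has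
characteristic polynomial `P_w · P_{τw}`. -/
theorem charpoly_fromBlocks_diag (A B : Matrix m m R) :
    (Matrix.fromBlocks A 0 0 B).charpoly = A.charpoly * B.charpoly :=
  Matrix.charpoly_fromBlocks_zero₁₂ A 0 B

/-- Sanity check tying §4 to the crux's `expand`: `(charpoly A)(X²)` has degree `2 · m`, the rank of
the induced block matrix — consistent with `natDegree_hostFactor` (`f(w∣v) = 2` at inert `v`). -/
theorem natDegree_charpoly_fromBlocks_zero_one [Nontrivial R] (A : Matrix m m R) :
    (Matrix.fromBlocks 0 A 1 0).charpoly.natDegree = Fintype.card m * 2 := by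
  rw [charpoly_fromBlocks_zero_one, natDegree_expand, Matrix.charpoly_natDegree_eq_dim]

end Blocks


/-! ## §5 Witness-free reduction (gen-2 §2 re-derived): the crux forces Satake uniqueness

The conclusion quantifies over EVERY family `α` of Satake parameters on the fibre.  Feeding it two
families that differ at one place `w₀ ∣ v` and comparing the two Frobenius polynomials of the SAME
`R` at `v` (unique, §2) gives `P_{w₀}(α)(X^f) · rest = P_{w₀}(β)(X^f) · rest`, whence `α = β` after
cancelling in `ℚ̄_ℓ[X]`, un-expanding and inverting `arithFrobPolyOfSatake`.  So any proof of the
crux proves, in passing, `hasSatakeParamAt_unique` for `π` at every place over a good `v`.  That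
fact is PROVED in the tree (`AutomorphicRepData.hasSatakeParamAt_unique_holds`, Flath; standard
axioms), so this is bookkeeping information for provers, not an obstruction and not a refutation. -/

section SatakeUnique

open scoped Classical

variable {F₀ F : Type} [Field F₀] [NumberField F₀] [Field F] [NumberField F] [Algebra F₀ F]
  {ℓ : ℕ} [Fact ℓ.Prime]

/-- Changing the family `α` at a place outside the fibre's complement of `w₀` does not change the
other factors: the host polynomial splits as `(factor at w₀) · (product over the rest)`. -/
theorem hostPoly_eq_mul_prod_erase (ι : PadicAlgCl ℓ ≃+* ℂ) (n : ℕ)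
    (α : HeightOneSpectrum (𝓞 F) → Multiset ℂ) (c : HeightOneSpectrum (𝓞 F) → ℂ)
    {v : HeightOneSpectrum (𝓞 F₀)} {w₀ : HeightOneSpectrum (𝓞 F)} (hw₀ : w₀ ∈ fibre F v) :
    hostPoly ι n α c v = hostFactor (F₀ := F₀) ι n α c w₀ *
      ∏ w ∈ (finite_fibre (F := F) v).toFinset.erase w₀, hostFactor (F₀ := F₀) ι n α c w := by
  rw [hostPoly_eq_prod, ← Finset.mul_prod_erase _ _ ((finite_fibre v).mem_toFinset.mpr hw₀)]

/-- The factors away from `w₀` only see `α` away from `w₀`. -/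
theorem prod_erase_update (ι : PadicAlgCl ℓ ≃+* ℂ) (n : ℕ)
    (α : HeightOneSpectrum (𝓞 F) → Multiset ℂ) (c : HeightOneSpectrum (𝓞 F) → ℂ)
    (v : HeightOneSpectrum (𝓞 F₀)) (w₀ : HeightOneSpectrum (𝓞 F)) (β : Multiset ℂ) :
    ∏ w ∈ (finite_fibre (F := F) v).toFinset.erase w₀, hostFactor (F₀ := F₀) ι n (Function.update α w₀ β) c w =
      ∏ w ∈ (finite_fibre (F := F) v).toFinset.erase w₀, hostFactor (F₀ := F₀) ι n α c w := by
  refine Finset.prod_congr rfl fun w hw ↦ ?_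
  rw [hostFactor, hostFactor, Function.update_of_ne (Finset.ne_of_mem_erase hw)]

/-- **`HostInducedRep` ⊢ uniqueness of Satake parameters over good places.**  Assume the crux.
Fix data satisfying its hypotheses, a good place `v` of `F₀` (`v ∤ ℓ`) with a guard family
`(α, c)` on its fibre, and a place `w₀ ∣ v`.  Then every Satake parameter `β` of `π` at `w₀` equals
`α w₀`.  (All hypotheses of the crux are passed through verbatim; nothing is constructed.) -/
theorem satake_unique_of_hostInducedRep (host : HostInducedRep)
    (τ : F ≃ₐ[F₀] F) (hTR : IsTotallyReal F₀) (hdeg : Module.finrank F₀ F = 2) (hτ : τ ≠ 1) (n : ℕ)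
    (hcpt : isCompact_glFiniteIntegralLevel n F) (π : CuspidalAutomorphicRepData n F hcpt)
    (e : FramedGaloisRep F₀ ℂ 1) (k : ℤ) (hreg : π.1.IsRegularAlgebraic)
    (hpol : ∀ᶠ w in cofinite, ∀ (α β : Multiset ℂ) (c : ℂ), π.1.HasSatakeParamAt w α →
      π.1.HasSatakeParamAt (τ • w) β → e.HasFrobCharpolyAt (w.under (𝓞 F₀)) (X - C c) →
      β = α.map (fun a ↦ a⁻¹ * (c * ((w.under (𝓞 F₀)).residueCard : ℂ) ^ k) ^
        w.asIdeal.inertiaDeg (𝓞 F₀)))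
    (hpar : (e.restrictField F).IsOdd ∨ ∀ (φ : F →+* ℝ) (c : Field.absoluteGaloisGroup F),
      IsComplexConjugation φ c → Matrix.GeneralLinearGroup.det ((e.restrictField F) c) = 1)
    (hodd : Odd n → (e.restrictField F).IsOdd) (ι : PadicAlgCl ℓ ≃+* ℂ)
    (hℓ : ¬ ((ℓ : ℤ) ∣ NumberField.discr F))
    (hunr : ∀ w : HeightOneSpectrum (𝓞 F), ((ℓ : ℕ) : 𝓞 F) ∈ w.asIdeal → π.1.IsUnramifiedAt w)
    (eψ : FramedGaloisRep F ℂ 1)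
    (hψunr : ∀ w : HeightOneSpectrum (𝓞 F), ((ℓ : ℕ) : 𝓞 F) ∈ w.asIdeal → eψ.IsUnramifiedAt w)
    (hψpar : ∀ (φ : F →+* ℝ) (c c' : Field.absoluteGaloisGroup F), IsComplexConjugation φ c →
      IsComplexConjugation (φ.comp (τ : F →+* F)) c' →
      Matrix.GeneralLinearGroup.det (eψ c) = Matrix.GeneralLinearGroup.det (eψ c'))
    (hψnti : ∃ᶠ w in cofinite, ∃ (α β : Multiset ℂ) (c c' : ℂ), π.1.HasSatakeParamAt w α ∧
      π.1.HasSatakeParamAt (τ • w) β ∧ eψ.HasFrobCharpolyAt w (X - C c) ∧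
      eψ.HasFrobCharpolyAt (τ • w) (X - C c') ∧ β.map (fun b ↦ b * c') ≠ α.map (fun a ↦ a * c))
    -- a good place with a guard family, and a competing Satake parameter at `w₀ ∣ v`
    {v : HeightOneSpectrum (𝓞 F₀)} (hv : ((ℓ : ℕ) : 𝓞 F₀) ∉ v.asIdeal)
    {α : HeightOneSpectrum (𝓞 F) → Multiset ℂ} {c : HeightOneSpectrum (𝓞 F) → ℂ}
    (hguard : ∀ w : HeightOneSpectrum (𝓞 F), w.under (𝓞 F₀) = v →
      w.asIdeal.ramificationIdx (𝓞 F₀) = 1 ∧ π.1.HasSatakeParamAt w (α w) ∧ eψ.IsUnramifiedAt w ∧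
      eψ.HasFrobCharpolyAt w (X - C (c w)))
    {w₀ : HeightOneSpectrum (𝓞 F)} (hw₀ : w₀.under (𝓞 F₀) = v) {β : Multiset ℂ}
    (hβ : π.1.HasSatakeParamAt w₀ β) :
    β = α w₀ := by
  obtain ⟨R, -, hR⟩ :=
    host F₀ F τ hTR hdeg hτ n hcpt π e k hreg hpol hpar hodd ℓ ι hℓ hunr eψ hψunr hψpar hψnti
  -- the competing family
  set α' : HeightOneSpectrum (𝓞 F) → Multiset ℂ := Function.update α w₀ β with hα'
  have hguard' : ∀ w : HeightOneSpectrum (𝓞 F), w.under (𝓞 F₀) = v →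
      w.asIdeal.ramificationIdx (𝓞 F₀) = 1 ∧ π.1.HasSatakeParamAt w (α' w) ∧ eψ.IsUnramifiedAt w ∧
      eψ.HasFrobCharpolyAt w (X - C (c w)) := by
    intro w hw
    obtain ⟨h1, h2, h3, h4⟩ := hguard w hw
    refine ⟨h1, ?_, h3, h4⟩
    by_cases hww : w = w₀
    · subst hww; rwa [hα', Function.update_self]
    · rwa [hα', Function.update_of_ne hww]
  -- two Frobenius polynomials of the same `R` at `v`
  have hP : R.HasFrobCharpolyAt v (hostPoly ι n α c v) := (hR v α c hv hguard).2
  have hP' : R.HasFrobCharpolyAt v (hostPoly ι n α' c v) := (hR v α' c hv hguard').2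
  have heq : hostPoly ι n α' c v = hostPoly ι n α c v := hasFrobCharpolyAt_unique' hP' hP
  rw [hostPoly_eq_mul_prod_erase ι n α' c (mem_fibre.mpr hw₀),
    hostPoly_eq_mul_prod_erase ι n α c (mem_fibre.mpr hw₀), hα', prod_erase_update] at heq
  -- cancel the common (monic, hence non-zero) cofactor
  have hne : (∏ w ∈ (finite_fibre (F := F) v).toFinset.erase w₀, hostFactor (F₀ := F₀) ι n α c w) ≠ 0 :=
    (monic_prod_of_monic _ _ fun w _ ↦ monic_hostFactor ι n α c w).ne_zero
  have hfac := mul_right_cancel₀ hne heq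
  -- un-expand and invert `arithFrobPolyOfSatake`
  rw [hostFactor, hostFactor, Function.update_self] at hfac
  have hfac' := expand_injective (inertiaDeg_pos (F₀ := F₀) w₀) hfac
  have hq : 0 < w₀.residueCard := lt_trans zero_lt_one w₀.one_lt_residueCard
  have hmul := arithFrobPolyOfSatake_injective ι hq n hfac'
  -- `c w₀` is a unit (value of the character `eψ` at a Frobenius)
  have hc : c w₀ ≠ 0 := (isUnit_of_hasFrobCharpolyAt_X_sub_C eψ (hguard w₀ hw₀).2.2.2).ne_zero
  exact Multiset.map_injective (mul_left_injective₀ hc) hmul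

/-- The same statement packaged against the named fact: under the crux, `hasSatakeParamAt_unique`
holds for `π` at all places over good `v` carrying a guard family (this is how a prover should
read §5: the fact is CONSUMED by any proof, at least at those places). -/
theorem satake_unique_of_hostInducedRep' (host : HostInducedRep)
    (τ : F ≃ₐ[F₀] F) (hTR : IsTotallyReal F₀) (hdeg : Module.finrank F₀ F = 2) (hτ : τ ≠ 1) (n : ℕ)
    (hcpt : isCompact_glFiniteIntegralLevel n F) (π : CuspidalAutomorphicRepData n F hcpt)
    (e : FramedGaloisRep F₀ ℂ 1) (k : ℤ) (hreg : π.1.IsRegularAlgebraic)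
    (hpol : ∀ᶠ w in cofinite, ∀ (α β : Multiset ℂ) (c : ℂ), π.1.HasSatakeParamAt w α →
      π.1.HasSatakeParamAt (τ • w) β → e.HasFrobCharpolyAt (w.under (𝓞 F₀)) (X - C c) →
      β = α.map (fun a ↦ a⁻¹ * (c * ((w.under (𝓞 F₀)).residueCard : ℂ) ^ k) ^
        w.asIdeal.inertiaDeg (𝓞 F₀)))
    (hpar : (e.restrictField F).IsOdd ∨ ∀ (φ : F →+* ℝ) (c : Field.absoluteGaloisGroup F),
      IsComplexConjugation φ c → Matrix.GeneralLinearGroup.det ((e.restrictField F) c) = 1)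
    (hodd : Odd n → (e.restrictField F).IsOdd) (ι : PadicAlgCl ℓ ≃+* ℂ)
    (hℓ : ¬ ((ℓ : ℤ) ∣ NumberField.discr F))
    (hunr : ∀ w : HeightOneSpectrum (𝓞 F), ((ℓ : ℕ) : 𝓞 F) ∈ w.asIdeal → π.1.IsUnramifiedAt w)
    (eψ : FramedGaloisRep F ℂ 1)
    (hψunr : ∀ w : HeightOneSpectrum (𝓞 F), ((ℓ : ℕ) : 𝓞 F) ∈ w.asIdeal → eψ.IsUnramifiedAt w)
    (hψpar : ∀ (φ : F →+* ℝ) (c c' : Field.absoluteGaloisGroup F), IsComplexConjugation φ c →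
      IsComplexConjugation (φ.comp (τ : F →+* F)) c' →
      Matrix.GeneralLinearGroup.det (eψ c) = Matrix.GeneralLinearGroup.det (eψ c'))
    (hψnti : ∃ᶠ w in cofinite, ∃ (α β : Multiset ℂ) (c c' : ℂ), π.1.HasSatakeParamAt w α ∧
      π.1.HasSatakeParamAt (τ • w) β ∧ eψ.HasFrobCharpolyAt w (X - C c) ∧
      eψ.HasFrobCharpolyAt (τ • w) (X - C c') ∧ β.map (fun b ↦ b * c') ≠ α.map (fun a ↦ a * c))
    {v : HeightOneSpectrum (𝓞 F₀)} (hv : ((ℓ : ℕ) : 𝓞 F₀) ∉ v.asIdeal)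
    {α : HeightOneSpectrum (𝓞 F) → Multiset ℂ} {c : HeightOneSpectrum (𝓞 F) → ℂ}
    (hguard : ∀ w : HeightOneSpectrum (𝓞 F), w.under (𝓞 F₀) = v →
      w.asIdeal.ramificationIdx (𝓞 F₀) = 1 ∧ π.1.HasSatakeParamAt w (α w) ∧ eψ.IsUnramifiedAt w ∧
      eψ.HasFrobCharpolyAt w (X - C (c w)))
    {w₀ : HeightOneSpectrum (𝓞 F)} (hw₀ : w₀.under (𝓞 F₀) = v) {β β' : Multiset ℂ}
    (hβ : π.1.HasSatakeParamAt w₀ β) (hβ' : π.1.HasSatakeParamAt w₀ β') : β = β' :=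
  (satake_unique_of_hostInducedRep host τ hTR hdeg hτ n hcpt π e k hreg hpol hpar hodd ι hℓ hunr eψ
      hψunr hψpar hψnti hv hguard hw₀ hβ).trans
    (satake_unique_of_hostInducedRep host τ hTR hdeg hτ n hcpt π e k hreg hpol hpar hodd ι hℓ hunr eψ
      hψunr hψpar hψnti hv hguard hw₀ hβ').symm

end SatakeUnique


/-! ## §6 NEW (gen-3): the controlled set versus the cited engine (Goldring–Koskivirta 3.5.5)

**Reading of the source** (arXiv:1507.05032, materialised pages): p. 9 "Let `Ram(G)` denote the set
of primes where `G` is ramified" — `G` is the unitary similitude `ℚ`-GROUP of a unitary Kottwitz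
datum, so these are RATIONAL primes, and `Ram(G) ⊇ {p : p ∣ disc F₀}` when `G ⊇ Res_{F₀/ℚ}`
(Weil restriction along a ramified `F₀,v/ℚ_p` has no hyperspecial subgroup); p. 14 "`Ram(π)` = the
set of places [of `ℚ`] where `π` is ramified, `Ram(G, π) = Ram(G) ∪ Ram(π)`"; p. 19, Thm 3.5.5:
compatibility "for all primes `w` of `F` which lie over some prime `v ∉ Ram(G, π)`", `p ∉ Ram(G,π)`.

**Consequence.**  After AI, BC to `K = K′F₀`, twist and descent, the engine controls `R` exactly at
the places of `F₀` over rational primes `p ≠ ℓ` with: `p ∤ disc F₀`, `p` unramified in `K′`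
(removable by patching two `K′`), and `F/F₀`, `π`, `ψ` unramified at EVERY place over `p`.  The crux
instead demands control at every single place `v ∤ ℓ` of `F₀` unramified in `F` with `π, eψ`
unramified above `v` — strictly more in two ways: (i) a good `v` sharing its rational prime with a
bad `v'`; (ii) EVERY `v` over a prime `p ∣ disc F₀`, for every `π` whatsoever.  Concrete instance of
(ii): `F₀ = ℚ(√3)` (`disc = 12`), `v = (√3)`, `F = F₀(√(1+√3))` — quadratic, of mixed signature
(`1+√3 > 0 > 1-√3`), unramified at `v` (`v ∤ 2(1+√3)`); the crux asks for `R` unramified at `v`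
with the induced characteristic polynomial, GK 3.5.5 is silent there (`3 ∈ Ram(G)`).  [Certification of
this instance: PARI/GP job `j008610` (gen-4, script `field_example.gp`: `disc F₀ = 12`,
`F = ℚ[x]/(x⁴ − 2x² − 2)` of signature `(2,1)`, valuation of the relative discriminant of `F/F₀` at
the prime above `3` equal to `0`); its summary is attached to the item automatically on completion.]  For `F` CM
or totally real this costs nothing (`exists_galoisRep_of_regularAlgebraic` = HLTT + Varma controls
every unramified `v ∤ ℓ`, and `R = Ind` inherits it), so the gap bites exactly in the NEW (mixed)
case the route is about.  (iii) Minor: p. 9 carries the standing assumption `p > 2` (`p` = the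
residue characteristic of the coefficients, our `ℓ`) for the Hodge-type integral models; Thm 3.5.5
does not restate it, so whether the engine serves `ℓ = 2` (allowed by the crux whenever
`2 ∤ disc F`) is not explicit in the source.  Not a refutation: the strong form is true under full
local–global compatibility; it is a PROVABILITY gap relative to the cited chain.

**Repair** (planner): replace the guard of the conclusion by the rational-prime guard below
(`HostInducedRepRatControl`); `TwistUnpackaging` must then consume the same weakened family, and
its COFINITE conclusion survives on paper: the places of `F` lost are those over the finite set of
rational primes `{ℓ} ∪ {p ∣ disc F₀} ∪ {p below Ram(F/F₀) ∪ Ram(π)}`, plus, in the separation step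
at a given `w`, the auxiliary `ψ` is chosen unramified above the prime below `w` (weak
approximation), so cofinitely many `w` keep a controlled `R_ψ`. -/

section Control

/-- The crux with the ENGINE-MATCHING controlled set: control at `v` is only demanded when every
place `v'` of `F₀` over the same rational prime is unramified over `ℚ`, unramified in `F`, and has
`π`, `eψ` unramified above it (hypotheses verbatim otherwise; the Satake/Frobenius data are still
read on the fibre of `v` only). -/
def HostInducedRepRatControl : Prop :=
  ∀ (F₀ F : Type) [Field F₀] [NumberField F₀] [Field F] [NumberField F] [Algebra F₀ F] (τ : F ≃ₐ[F₀] F), NumberField.IsTotallyReal F₀ → Module.finrank F₀ F = 2 → τ ≠ 1 → ∀ (n : ℕ) (hcpt : Literature.NumberTheory.Automorphic.isCompact_glFiniteIntegralLevel n F) (π : Literature.NumberTheory.Automorphic.CuspidalAutomorphicRepData n F hcpt) (e : Literature.NumberTheory.GaloisRepresentations.FramedGaloisRep F₀ ℂ 1) (k : ℤ), π.1.IsRegularAlgebraic → (∀ᶠ w in Filter.cofinite, ∀ (α β : Multiset ℂ) (c : ℂ), π.1.HasSatakeParamAt w α → π.1.HasSatakeParamAt (τ • w) β → e.HasFrobCharpolyAt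 (w.under (NumberField.RingOfIntegers F₀)) (Polynomial.X - Polynomial.C c) → β = α.map (fun a ↦ a⁻¹ * (c * ((w.under (NumberField.RingOfIntegers F₀)).residueCard : ℂ) ^ k) ^ w.asIdeal.inertiaDeg (NumberField.RingOfIntegers F₀))) → ((e.restrictField F).IsOdd ∨ ∀ (φ : F →+* ℝ) (c : Field.absoluteGaloisGroup F), Literature.NumberTheory.GaloisRepresentations.IsComplexConjugation φ c → Matrix.GeneralLinearGroup.det ((e.restrictField F) c) = 1) → (Odd n → (e.restrictField F).IsOdd) → ∀ (ℓ : ℕ) [Fact ℓ.Prime] (ι : PadicAlgCl ℓ ≃+* ℂ), ¬ ((ℓ : ℤ) ∣ NumberField.discr F) → (∀ w : IsDedekindDomain.HeightOneSpectrum (NumberField.RingOfIntegers F), ((ℓ : ℕ) : NumberField.RingOfIntegers F) ∈ w.asIdeal → π.1.IsUnramifiedAt w) → ∀ eψ : Literature.NumberTheory.GaloisRepresentations.FramedGaloisRep F ℂ 1, (∀ w : IsDedekindDomain.HeightOneSpectrum (NumberField.RingOfIntegers F), ((ℓ : ℕ) : NumberField.RingOfIntegers F) ∈ w.asIdeal →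 eψ.IsUnramifiedAt w) → (∀ (φ : F →+* ℝ) (c c' : Field.absoluteGaloisGroup F), Literature.NumberTheory.GaloisRepresentations.IsComplexConjugation φ c → Literature.NumberTheory.GaloisRepresentations.IsComplexConjugation (φ.comp (τ : F →+* F)) c' → Matrix.GeneralLinearGroup.det (eψ c) = Matrix.GeneralLinearGroup.det (eψ c')) → (∃ᶠ w in Filter.cofinite, ∃ (α β : Multiset ℂ) (c c' : ℂ), π.1.HasSatakeParamAt w α ∧ π.1.HasSatakeParamAt (τ • w) β ∧ eψ.HasFrobCharpolyAt w (Polynomial.X - Polynomial.C c) ∧ eψ.HasFrobCharpolyAt (τ • w) (Polynomial.X - Polynomial.C c') ∧ β.map (fun b ↦ b * c') ≠ α.map (fun a ↦ a * c)) → ∃ R : Literature.NumberTheory.GaloisRepresentations.FramedGaloisRep F₀ (PadicAlgCl ℓ) (2 * n), R.toGaloisRep.IsSemisimple ∧ ∀ (v : IsDedekindDomain.HeightOneSpectrum (NumberField.RingOfIntegers F₀)) (α : _ → Multiset ℂ) (c : _ → ℂ), ((ℓ : ℕ) : NumberField.RingOfIntegers F₀) ∉ v.asIdeal →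
    -- rational-prime guard: every `v'` over the same rational prime is good
    (∀ v' : IsDedekindDomain.HeightOneSpectrum (NumberField.RingOfIntegers F₀), v'.asIdeal.under ℤ = v.asIdeal.under ℤ → v'.asIdeal.ramificationIdx ℤ = 1 ∧ ∀ w' : IsDedekindDomain.HeightOneSpectrum (NumberField.RingOfIntegers F), w'.under (NumberField.RingOfIntegers F₀) = v' → w'.asIdeal.ramificationIdx (NumberField.RingOfIntegers F₀) = 1 ∧ π.1.IsUnramifiedAt w' ∧ eψ.IsUnramifiedAt w') →
    -- data on the fibre of `v`
    (∀ w : IsDedekindDomain.HeightOneSpectrum (NumberField.RingOfIntegers F), w.under (NumberField.RingOfIntegers F₀) = v → π.1.HasSatakeParamAt w (α w) ∧ eψ.HasFrobCharpolyAt w (Polynomial.X - Polynomial.C (c w))) → R.IsUnramifiedAt v ∧ R.HasFrobCharpolyAt v (∏ᶠ w ∈ {w : IsDedekindDomain.HeightOneSpectrum (NumberField.RingOfIntegers F) | w.under (NumberField.RingOfIntegers F₀) = v}, Polynomial.expand (PadicAlgCl ℓ) (w.asIdeal.inertiaDeg (NumberField.RingOfIntegers F₀)) (Literature.NumberTheory.Automorphic.arithFrobPolyOfSatake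 ι w.residueCard n ((α w).map (fun a ↦ a * c w))))

/-- **The crux implies its engine-matching weakening** (monotonicity in the controlled set: the
rational-prime guard at `v` contains the crux's place-wise guard at `v`, the unramifiedness of `eψ`
on the fibre being supplied by the guard — or, redundantly, by the Frobenius clause, §2). -/
theorem hostInducedRepRatControl_of_hostInducedRep (host : HostInducedRep) :
    HostInducedRepRatControl := by
  intro F₀ F _ _ _ _ _ τ hTR hdeg hτ n hcpt π e k hreg hpol hpar hodd ℓ _ ι hℓ hunr eψ hψunr hψpar hψnti
  obtain ⟨R, hss, hR⟩ :=
    host F₀ F τ hTR hdeg hτ n hcpt π e k hreg hpol hpar hodd ℓ ι hℓ hunr eψ hψunr hψpar hψnti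
  refine ⟨R, hss, fun v α c hv hrat hdata ↦ hR v α c hv fun w hw ↦ ?_⟩
  obtain ⟨-, hfib⟩ := hrat v rfl
  obtain ⟨he, -, hψ⟩ := hfib w hw
  exact ⟨he, (hdata w hw).1, hψ, (hdata w hw).2⟩

end Control

/-! ## §7–§8 Paper ledger (docstring only; see the module docblock)

Nothing in §7–§8 is a refutation of the typed item.  For the record, the attacks run in this
generation that produced NO kill: junk/degenerate models (`n = 0`: true; `τ = 1`: excluded by
hypothesis and vacuous anyway since Satake/Frobenius data are `τ`-equivariant; `F` CM or totally
real: the statement follows from `exists_galoisRep_of_regularAlgebraic` + induction, so no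
counterexample lives there; `n = 1`: CFT, every Frobenius convention absorbed by `∃ R`);
convention audit of the conclusion (arithmetic Frobenius throughout — `HasFrobCharpolyAt` for `eψ`
at `w` and for `R` at `v` use the same `IsArithFrobAt`; `expand f` = `det(X^f - r(Frob_w))`, §4;
`residueCard` of `w` not `v` inside `P_w`, correct; the twist `α ↦ α·c` is `ρ_π ⊗ ẽψ⁻¹` with
`ẽψ = ι⁻¹ ∘ eψ`, inversion-symmetric); interface audit (`HasSatakeParamAt` pins `card α = n` and is
an honest Hecke-eigenvector condition, `FramedGaloisRep _ ℂ 1` is continuous hence finite-image,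
`inertiaDeg`/`ramificationIdx` are Mathlib's genuine single-ideal invariants — no junk escape). -/


/-! ## §8bis (gen-3, paper, conventions NOT fully pinned — for the planner/lead, not a verdict)
### Refined archimedean sign bookkeeping of the engine (risk (a))

Let `Π = AI_{F/F₀}(π ⊗ ψ⁻¹)` (`η_Π`-self-dual: `Π^∨ ≅ Π ⊗ η_Π⁻¹`, and also `η_Π ω`-self-dual since
`Π ≅ Π ⊗ ω`, `ω = ω_{F/F₀}`), `K = K′F₀` CM, `ω_K = ω_{K/F₀}`.  `Π_K ⊗ ψ₀` is conjugate self-dual iff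
`r := ψ₀|_{𝔸_{F₀}^×} ∈ η_Π⁻¹·{1, ω, ω_K, ω ω_K}` (four classes, because of the self-twist).  With
`As⁻(Π_K) = Sym²Π ⊗ ω_K ⊕ ∧²Π` and `Π ⊗ Π ⊇ η_Π ⊕ η_Π ω` (one in `Sym²`, the other in `∧²`, say
`η_Π ω^a ∈ Sym²`), the conjugate-SYMPLECTIC classes (the ones Mok-descending to `U(n,n)`) are the TWO
classes `r₁ = η_Π⁻¹ ω^a ω_K`, `r₂ = η_Π⁻¹ ω^{1-a}`; they differ by `ω ω_K`, i.e. by `-1` at the real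
places of `F₀` SPLIT in `F` and by `+1` at the NON-split ones.  The `U(n,n)`-descent is in the
(automatically non-degenerate) LDS packet at a real `v` iff the twisted exponents lie in `½ + ℤ`, a
condition on `r_v(-1)` alone (`= (-1)^w` for even `n`, `= -1` for odd `n`, `w` the purity weight).
Consequences (n = 1 checked against the weight-one/Maass dichotomy through `GU(1,1) = (GL₂ × K^×)/F₀^×`;
n = 2 checked on the `BC(σ) ⊗ λ` family):
* split places: the engine needs `v ↦ η_{Π,v}(-1)` CONSTANT on the split real places — EITHER
  constant, one of `r₁, r₂` serving each sign.  This is exactly the typed `hpar`; the extra `hodd`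
  (odd `n ⇒` odd sign) looks UNNECESSARY even for the engine (for `n = 1` the all-even case is served
  by the `ω ω_K`-twisted descent, whose `GU(1,1)`-avatar is a weight-one form base-changing, up to
  a non-`c`-invariant twist, to the same `Π_K ⊗ ψ₀`).  Mutation note only: `hodd` possibly droppable.
* non-split places: both options impose the SAME condition `η_{Π,v}(-1)·(-1)^{a+1} = required sign`
  at every non-split real `v`.  For odd `n` it is automatic (the `η̃`-form on `Ind ρ` of symplectic
  type forces `η̃(c_v) = -1` at non-split `v`: an isometric involution of a symplectic space has
  even-dimensional eigenspaces, here of dimension `n`).  For even `n` linear algebra forces nothing: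
  this is the residual SIGN LAW (route risk (a), gen-1 P1/P2) in its sharpest form — a parity law at
  the NON-split real places relating the polarization sign of `(ρ_π, η)` to `w`.  Its failure for
  some `π` would kill the ENGINE for that `π`, never the typed item (`R = Ind(ρ_π ⊗ ẽψ⁻¹)` exists
  whenever `ρ_π` does). -/


/-! ## §9 NEW (gen-4): the exact axiom shape behind "TRUE under the summit"

`HostInducedRep` is the composite of ONE automorphic statement and ONE Galois-theoretic statement,
and nothing else:

* `TwistedStrongReciprocityAt π eψ ℓ ι` — conjunct (A) of the summit in its strong, place-by-place
  form for the single twisted representation `π ⊗ ψ̃⁻¹`, read (exactly as the crux reads it) through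
  `π`'s Satake data and `eψ`'s arithmetic-Frobenius values: a semisimple `ρ' : Γ_F → GL_n(ℚ̄_ℓ)`,
  unramified with characteristic polynomial `arithFrobPolyOfSatake ι q_w n (α_w · c_w)` at EVERY
  `w ∤ ℓ` where `π` has parameter `α_w` and `eψ` is unramified with value `c_w`;
* `HasQuadraticInduction F₀ F ℓ n` — what `R = Ind_{Γ_F}^{Γ_{F₀}} ρ'` provides at the places of
  `F₀` unramified in `F` (pure Galois theory; §3b/§4 of this file compute the polynomial
  `∏_{w ∣ v} P_w(X^{f(w∣v)})`; the tree already has `absGaloisRestrict_injective`,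
  `normal_range_absGaloisRestrict`, `index_range_absGaloisRestrict`, `orderOf_frobenius_eq_inertiaDeg`
  towards an honest construction of `Ind`, not attempted in this cycle).

`hostInducedRep_of_reciprocity_of_induction`: both, for all data ⟹ `HostInducedRep`; the proof
touches NO hypothesis of the crux except the guard family and `hdeg` — `hTR, hτ, hreg, hpol, hpar,
hodd, hℓ, hunr, hψunr, hψpar, hψnti` are merely forwarded to the reciprocity oracle.  Reading for
the disprover: a counterexample to the crux IS a counterexample to place-by-place reciprocity for
some regular algebraic cuspidal `π ⊗ ψ̃⁻¹` over `F` (or to index-two induction) — this is the typed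
form of the one-shot attack's "restates-target" finding and the reason no `¬`-theorem exists.
Conversely the crux for all admissible `eψ` feeds `TwistUnpackaging`, whose output is reciprocity
for `π`: the two cruxes are each other's converses modulo induction / Clifford theory.

The telescope `HostInducedRepVia` (the crux's binders and hypotheses with a swappable conclusion,
`hostInducedRep_iff_via : HostInducedRep ↔ HostInducedRepVia HostConclusion` by `Iff.rfl`) is the
device; §5's reduction reads `HostInducedRep → HostInducedRepVia (Satake uniqueness on good fibres)`
in the same language. -/

section AxiomShape

/-- The crux's binder-and-hypothesis telescope with a SWAPPABLE conclusion `Concl` (verbatim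
hypotheses of `QuadraticWindow.HostInducedRep`; `Concl` receives the base field, the field, the
rank, the level witness, `π`, the Artin avatar `eψ`, `ℓ` and `ι`). -/
def HostInducedRepVia
    (Concl : ∀ (F₀ F : Type) [Field F₀] [NumberField F₀] [Field F] [NumberField F] [Algebra F₀ F]
      (n : ℕ) (hcpt : Literature.NumberTheory.Automorphic.isCompact_glFiniteIntegralLevel n F),
      Literature.NumberTheory.Automorphic.CuspidalAutomorphicRepData n F hcpt →
      Literature.NumberTheory.GaloisRepresentations.FramedGaloisRep F ℂ 1 → ∀ (ℓ : ℕ) [Fact ℓ.Prime],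
      (PadicAlgCl ℓ ≃+* ℂ) → Prop) : Prop :=
  ∀ (F₀ F : Type) [Field F₀] [NumberField F₀] [Field F] [NumberField F] [Algebra F₀ F] (τ : F ≃ₐ[F₀] F), NumberField.IsTotallyReal F₀ → Module.finrank F₀ F = 2 → τ ≠ 1 → ∀ (n : ℕ) (hcpt : Literature.NumberTheory.Automorphic.isCompact_glFiniteIntegralLevel n F) (π : Literature.NumberTheory.Automorphic.CuspidalAutomorphicRepData n F hcpt) (e : Literature.NumberTheory.GaloisRepresentations.FramedGaloisRep F₀ ℂ 1) (k : ℤ), π.1.IsRegularAlgebraic → (∀ᶠ w in Filter.cofinite, ∀ (α β : Multiset ℂ) (c : ℂ), π.1.HasSatakeParamAt w α → π.1.HasSatakeParamAt (τ • w) β → e.HasFrobCharpolyAt (w.under (NumberField.RingOfIntegers F₀)) (Polynomial.X - Polynomial.C c) → β = α.map (fun a ↦ a⁻¹ * (c * ((w.under (NumberField.RingOfIntegers F₀)).residueCard : ℂ) ^ k) ^ w.asIdeal.inertiaDeg (NumberField.RingOfIntegers F₀))) → ((e.restrictField F).IsOdd ∨ ∀ (φ : F →+* ℝ) (c : Field.absoluteGaloisGroup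 F), Literature.NumberTheory.GaloisRepresentations.IsComplexConjugation φ c → Matrix.GeneralLinearGroup.det ((e.restrictField F) c) = 1) → (Odd n → (e.restrictField F).IsOdd) → ∀ (ℓ : ℕ) [Fact ℓ.Prime] (ι : PadicAlgCl ℓ ≃+* ℂ), ¬ ((ℓ : ℤ) ∣ NumberField.discr F) → (∀ w : IsDedekindDomain.HeightOneSpectrum (NumberField.RingOfIntegers F), ((ℓ : ℕ) : NumberField.RingOfIntegers F) ∈ w.asIdeal → π.1.IsUnramifiedAt w) → ∀ eψ : Literature.NumberTheory.GaloisRepresentations.FramedGaloisRep F ℂ 1, (∀ w : IsDedekindDomain.HeightOneSpectrum (NumberField.RingOfIntegers F), ((ℓ : ℕ) : NumberField.RingOfIntegers F) ∈ w.asIdeal → eψ.IsUnramifiedAt w) → (∀ (φ : F →+* ℝ) (c c' : Field.absoluteGaloisGroup F), Literature.NumberTheory.GaloisRepresentations.IsComplexConjugation φ c → Literature.NumberTheory.GaloisRepresentations.IsComplexConjugation (φ.comp (τ : F →+* F)) c' → Matrix.GeneralLinearGroup.det (eψ c) = Matrix.GeneralLinearGroup.det (eψ c')) → (∃ᶠ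 w in Filter.cofinite, ∃ (α β : Multiset ℂ) (c c' : ℂ), π.1.HasSatakeParamAt w α ∧ π.1.HasSatakeParamAt (τ • w) β ∧ eψ.HasFrobCharpolyAt w (Polynomial.X - Polynomial.C c) ∧ eψ.HasFrobCharpolyAt (τ • w) (Polynomial.X - Polynomial.C c') ∧ β.map (fun b ↦ b * c') ≠ α.map (fun a ↦ a * c)) →
    Concl F₀ F n hcpt π eψ ℓ ι

/-- The crux's conclusion for fixed data (verbatim): the induced package `R` over `F₀`. -/
def HostConclusion (F₀ F : Type) [Field F₀] [NumberField F₀] [Field F] [NumberField F] [Algebra F₀ F]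
    (n : ℕ) (hcpt : isCompact_glFiniteIntegralLevel n F) (π : CuspidalAutomorphicRepData n F hcpt)
    (eψ : FramedGaloisRep F ℂ 1) (ℓ : ℕ) [Fact ℓ.Prime] (ι : PadicAlgCl ℓ ≃+* ℂ) : Prop :=
  ∃ R : Literature.NumberTheory.GaloisRepresentations.FramedGaloisRep F₀ (PadicAlgCl ℓ) (2 * n), R.toGaloisRep.IsSemisimple ∧ ∀ (v : IsDedekindDomain.HeightOneSpectrum (NumberField.RingOfIntegers F₀)) (α : _ → Multiset ℂ) (c : _ → ℂ), ((ℓ : ℕ) : NumberField.RingOfIntegers F₀) ∉ v.asIdeal → (∀ w : IsDedekindDomain.HeightOneSpectrum (NumberField.RingOfIntegers F), w.under (NumberField.RingOfIntegers F₀) = v → w.asIdeal.ramificationIdx (NumberField.RingOfIntegers F₀) = 1 ∧ π.1.HasSatakeParamAt w (α w) ∧ eψ.IsUnramifiedAt w ∧ eψ.HasFrobCharpolyAt w (Polynomial.X - Polynomial.C (c w))) → R.IsUnramifiedAt v ∧ R.HasFrobCharpolyAt v (∏ᶠ w ∈ {w : IsDedekindDomain.HeightOneSpectrum (NumberField.RingOfIntegers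 F) | w.under (NumberField.RingOfIntegers F₀) = v}, Polynomial.expand (PadicAlgCl ℓ) (w.asIdeal.inertiaDeg (NumberField.RingOfIntegers F₀)) (Literature.NumberTheory.Automorphic.arithFrobPolyOfSatake ι w.residueCard n ((α w).map (fun a ↦ a * c w))))

/-- The crux IS its telescope applied to its conclusion (definitional). -/
theorem hostInducedRep_iff_via : HostInducedRep ↔ HostInducedRepVia HostConclusion := Iff.rfl

variable {F₀ F : Type} [Field F₀] [NumberField F₀] [Field F] [NumberField F] [Algebra F₀ F]

/-- **Place-by-place reciprocity for the twist `π ⊗ ψ̃⁻¹`**, read through `π`'s Satake parameters and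
the Frobenius values of the Artin avatar `eψ` (so that no Hecke character and no class field theory
enter the statement): a semisimple `ρ' : Γ_F → GL_n(ℚ̄_ℓ)` which at every `w ∤ ℓ` carrying a Satake
parameter `α` of `π` and an unramified Frobenius value `c` of `eψ` is unramified with characteristic
polynomial `arithFrobPolyOfSatake ι q_w n (α · c)` (roots `ι⁻¹(c)⁻¹ · ι⁻¹((q_w^{(n-1)/2} α_j)⁻¹)`, i.e.
`ρ' = ρ_π ⊗ ẽψ⁻¹`).  This is conjunct (A) of the summit, strong (controlled, not cofinite) form, for
ONE regular algebraic cuspidal representation of `GL_n/F` — the thing the route is built to prove. -/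
def TwistedStrongReciprocityAt {n : ℕ} {hcpt : isCompact_glFiniteIntegralLevel n F}
    (π : CuspidalAutomorphicRepData n F hcpt) (eψ : FramedGaloisRep F ℂ 1) (ℓ : ℕ) [Fact ℓ.Prime]
    (ι : PadicAlgCl ℓ ≃+* ℂ) : Prop :=
  ∃ ρ : FramedGaloisRep F (PadicAlgCl ℓ) n, ρ.toGaloisRep.IsSemisimple ∧
    ∀ (w : HeightOneSpectrum (𝓞 F)) (α : Multiset ℂ) (c : ℂ), ((ℓ : ℕ) : 𝓞 F) ∉ w.asIdeal →
      π.1.HasSatakeParamAt w α → eψ.IsUnramifiedAt w → eψ.HasFrobCharpolyAt w (X - C c) →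
      ρ.IsUnramifiedAt w ∧
        ρ.HasFrobCharpolyAt w (arithFrobPolyOfSatake ι w.residueCard n (α.map (fun a ↦ a * c)))

variable (F₀ F) in
/-- **Abstract quadratic induction on the Galois side** (a black box for `R = Ind_{Γ_F}^{Γ_{F₀}} ρ`,
`[F : F₀] = 2`): for every semisimple `ρ : Γ_F → GL_n(ℚ̄_ℓ)` a semisimple `R : Γ_{F₀} → GL_{2n}(ℚ̄_ℓ)`
which, at every place `v` of `F₀` unramified in `F` above which `ρ` is unramified with Frobenius
polynomials `P_w`, is unramified with Frobenius polynomial `∏_{w ∣ v} P_w(X^{f(w∣v)})`.  TRUE (Mackey: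
`R|_{Γ_F} = ρ ⊕ ρ^τ`; at split `v` the block-diagonal identity `charpoly_fromBlocks_diag`, at inert
`v` `charpoly_fromBlocks_zero_one` of §4 with `Frob_v² = Frob_w`; semisimplicity by averaging over
`Γ_{F₀}/Γ_F`, `2` being invertible), but not yet a theorem of the tree. -/
def HasQuadraticInduction (ℓ : ℕ) [Fact ℓ.Prime] (n : ℕ) : Prop :=
  ∀ ρ : FramedGaloisRep F (PadicAlgCl ℓ) n, ρ.toGaloisRep.IsSemisimple →
    ∃ R : FramedGaloisRep F₀ (PadicAlgCl ℓ) (2 * n), R.toGaloisRep.IsSemisimple ∧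
      ∀ (v : HeightOneSpectrum (𝓞 F₀)) (P : HeightOneSpectrum (𝓞 F) → (PadicAlgCl ℓ)[X]),
        (∀ w : HeightOneSpectrum (𝓞 F), w.under (𝓞 F₀) = v →
          w.asIdeal.ramificationIdx (𝓞 F₀) = 1 ∧ ρ.IsUnramifiedAt w ∧ ρ.HasFrobCharpolyAt w (P w)) →
        R.IsUnramifiedAt v ∧ R.HasFrobCharpolyAt v
          (∏ᶠ w ∈ {w : HeightOneSpectrum (𝓞 F) | w.under (𝓞 F₀) = v},
            expand (PadicAlgCl ℓ) (w.asIdeal.inertiaDeg (𝓞 F₀)) (P w))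

omit [NumberField F₀] [NumberField F] in
/-- A rational prime lies in `w` iff it lies in the place of `F₀` below `w` (copy of the tree's
`HarrisLanTaylorThorne2016.natCast_mem_iff_natCast_mem_under`, to spare the import). -/
theorem natCast_mem_iff_natCast_mem_under' (w : HeightOneSpectrum (𝓞 F)) (q : ℕ) :
    ((q : ℕ) : 𝓞 F) ∈ w.asIdeal ↔ ((q : ℕ) : 𝓞 F₀) ∈ (w.under (𝓞 F₀)).asIdeal := by
  rw [HeightOneSpectrum.under_asIdeal, Ideal.under_def, Ideal.mem_comap, map_natCast]

/-- **Reciprocity for the twist + quadratic induction ⟹ the crux's conclusion**, for fixed data.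
The guard family `(α, c)` on the fibre of a good `v` is fed place by place to the reciprocity
oracle (`ℓ ∉ w` because `ℓ ∉ v = w ∩ 𝓞 F₀`), and the induction black box returns exactly the
crux's polynomial `∏_{w ∣ v} expand f(w∣v) (arithFrobPolyOfSatake ι q_w n (α_w · c_w))`. -/
theorem hostConclusion_of_reciprocity_of_induction {n : ℕ} {hcpt : isCompact_glFiniteIntegralLevel n F}
    (π : CuspidalAutomorphicRepData n F hcpt) (eψ : FramedGaloisRep F ℂ 1) (ℓ : ℕ) [Fact ℓ.Prime]
    (ι : PadicAlgCl ℓ ≃+* ℂ) (hrec : TwistedStrongReciprocityAt π eψ ℓ ι)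
    (hind : HasQuadraticInduction F₀ F ℓ n) : HostConclusion F₀ F n hcpt π eψ ℓ ι := by
  obtain ⟨ρ, hρss, hρ⟩ := hrec
  obtain ⟨R, hRss, hR⟩ := hind ρ hρss
  refine ⟨R, hRss, fun v α c hv hguard ↦
    hR v (fun w ↦ arithFrobPolyOfSatake ι w.residueCard n ((α w).map (fun a ↦ a * c w))) fun w hw ↦ ?_⟩
  obtain ⟨he, hsat, hψu, hψc⟩ := hguard w hw
  refine ⟨he, hρ w (α w) (c w) ?_ hsat hψu hψc⟩
  rw [natCast_mem_iff_natCast_mem_under' (F₀ := F₀) w ℓ, hw]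
  exact hv

/-- **`HostInducedRep` ⟸ (place-by-place reciprocity for every admissible twist) ∧ (quadratic
induction).**  The reciprocity oracle is granted exactly the crux's hypotheses (so a prover may use
every one of them to produce `ρ'`); induction is granted for quadratic `F/F₀`.  No other input. -/
theorem hostInducedRep_of_reciprocity_of_induction
    (hrec : HostInducedRepVia fun _ _ _ _ _ _ _ _ _ π eψ ℓ _ ι ↦ TwistedStrongReciprocityAt π eψ ℓ ι)
    (hind : ∀ (F₀ F : Type) [Field F₀] [NumberField F₀] [Field F] [NumberField F] [Algebra F₀ F]
      (ℓ : ℕ) [Fact ℓ.Prime] (n : ℕ), Module.finrank F₀ F = 2 → HasQuadraticInduction F₀ F ℓ n) :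
    HostInducedRep := by
  intro F₀ F _ _ _ _ _ τ hTR hdeg hτ n hcpt π e k hreg hpol hpar hodd ℓ _ ι hℓ hunr eψ hψunr hψpar hψnti
  exact hostConclusion_of_reciprocity_of_induction π eψ ℓ ι
    (hrec F₀ F τ hTR hdeg hτ n hcpt π e k hreg hpol hpar hodd ℓ ι hℓ hunr eψ hψunr hψpar hψnti)
    (hind F₀ F ℓ n hdeg)

/-- The same factorisation read backwards: the crux hands the reciprocity-plus-induction OUTPUT to
whoever holds its hypotheses — in particular (eψ := 1 is admissible when `π` is not `τ`-invariant,
cf. `TwistUnpackaging`'s docstring) any proof of the crux proves, place by place over `F₀`, what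
conjunct (A) + induction would give.  Stated as the trivial projection for the record. -/
theorem hostConclusion_of_hostInducedRep (host : HostInducedRep) :
    HostInducedRepVia HostConclusion :=
  hostInducedRep_iff_via.mp host

end AxiomShape


/-! ## §11 NEW (gen-4): quadratic induction of CHARACTERS is a theorem of the tree

`HasQuadraticInduction F₀ F ℓ 1` holds outright: the tree's `FramedGaloisRep.induce`
(`GaloisRepresentations/InducedGaloisRep`) supplies `Ind_{Γ_F}^{Γ_{F₀}} ρ` of rank `2 * 1`, Ash's
`FramedGaloisRep.exists_charpoly_induce_eq_prod` its Frobenius polynomial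
`∏_{w ∣ v} (X^{f(w∣v)} - ρ(Frob_w))` at places whose inertia lies in `res(Γ_F)`,
`inertia_le_range_absGaloisRestrict` + `ramificationIdxIn_eq_one_of_isUnramifiedIn` turn the crux's
arithmetic guard `e(w∣v) = 1` into that Galois-theoretic hypothesis, `isUnramifiedAt_induce` gives
unramifiedness, and the every-rank continuous semisimplification
(`IrreducibleGL3CM.stub_continuousSemisimplification`, a landed Theorems file of a sibling route)
makes the witness semisimple without touching its characteristic polynomials or its kernel.  So at
`n = 1` the Galois half of §9 is discharged: `HostInducedRepAt 1` is implied by place-by-place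
reciprocity for the rank-one twists alone (`hostInducedRepAt_one_of_reciprocity`), i.e. by
Weil's `ℓ`-adic characters + Artin reciprocity for `eψ` — no counterexample to the crux lives in
rank one unless class field theory fails.  For general `n` the same assembly goes through verbatim
once `exists_charpoly_induce_eq_prod` is upgraded from characters to blocks (the `f ∈ {1, 2}`
block identities are §4 of this file). -/

section InductionOne

variable {F₀ F : Type} [Field F₀] [NumberField F₀] [Field F] [NumberField F] [Algebra F₀ F]
  {ℓ : ℕ} [Fact ℓ.Prime]

omit [Fact ℓ.Prime] in
/-- `expand f (X - C a) = X ^ f - C a`. -/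
theorem expand_X_sub_C {R : Type*} [CommRing R] (f : ℕ) (a : R) :
    expand R f (X - C a) = X ^ f - C a := by
  rw [map_sub, expand_X, expand_C]

omit [Fact ℓ.Prime] in
/-- A product over a `Fintype` subtype `{a // p a}` is the `finprod` over the set `{a | p a}`
(bridge between Ash's `∏ w : {w // w ∣ v}` and the crux's `∏ᶠ w ∈ {w | w ∣ v}`). -/
theorem prod_subtype_eq_finprod_mem_setOf {α M : Type*} [CommMonoid M] (p : α → Prop)
    [Fintype {a // p a}] (hfin : {a | p a}.Finite) (f : α → M) :
    ∏ a : {a // p a}, f a = ∏ᶠ a ∈ {a | p a}, f a := by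
  classical
  rw [finprod_mem_eq_finite_toFinset_prod f hfin]
  exact (Finset.prod_subtype (p := p) hfin.toFinset (fun x ↦ by exact hfin.mem_toFinset) f).symm

/-- **`HasQuadraticInduction F₀ F ℓ 1` (induction of characters along the quadratic `F/F₀`) is a
theorem**, assembled from the tree as described in the section docstring. -/
theorem hasQuadraticInduction_one (hdeg : Module.finrank F₀ F = 2) :
    HasQuadraticInduction F₀ F ℓ 1 := by
  classical
  intro ρ _
  haveI := isGalois_of_finrank_eq_two hdeg
  -- the induced representation and its continuous semisimplification
  obtain ⟨R, hRss, hRchar, hRone⟩ :=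
    Summit.Langlands.Langlands.Theorems.IrreducibleGL3CM.stub_continuousSemisimplification F₀ ℓ
      (2 * 1) (FramedGaloisRep.induce F₀ hdeg ρ)
  refine ⟨R, hRss, fun v P hfib ↦ ?_⟩
  -- the arithmetic guard makes `v` unramified in `F`, so inertia above `v` lies in `res(Γ_F)`
  have hunrIn : Algebra.IsUnramifiedIn (𝓞 F) v.asIdeal := by
    rw [Algebra.isUnramifiedIn_iff_forall_ramificationIdx_eq_one]
    intro 𝔓 _ h𝔓
    have hne : 𝔓 ≠ ⊥ := Ideal.ne_bot_of_liesOver_of_ne_bot v.ne_bot 𝔓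
    exact (hfib ⟨𝔓, inferInstance, hne⟩ (HeightOneSpectrum.ext h𝔓.over.symm)).1
  have he : v.asIdeal.ramificationIdxIn (𝓞 F) = 1 :=
    Literature.NumberTheory.GaloisRepresentations.ramificationIdxIn_eq_one_of_isUnramifiedIn hunrIn
  have hIn : ∀ 𝔓 ∈ v.primesAbove,
      𝔓.inertia (Field.absoluteGaloisGroup F₀) ≤ (absGaloisRestrict F₀ F).range :=
    fun 𝔓 h𝔓 ↦
      Literature.NumberTheory.GaloisRepresentations.inertia_le_range_absGaloisRestrict F₀ F he h𝔓
  -- `Ind ρ` is unramified at `v`, hence so is its semisimplification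
  have hIunr : (FramedGaloisRep.induce F₀ hdeg ρ).IsUnramifiedAt v :=
    FramedGaloisRep.isUnramifiedAt_induce F₀ hdeg ρ hIn fun w hw ↦
      (hfib w (HeightOneSpectrum.ext (by rw [HeightOneSpectrum.under_asIdeal]; exact hw))).2.1
  refine ⟨fun 𝔓 h𝔓 σ hσ ↦ hRone σ (hIunr 𝔓 h𝔓 σ hσ), fun 𝔓 h𝔓 σ hσ ↦ ?_⟩
  -- Frobenius polynomial of `Ind ρ` at `σ` (Ash): `∏_{w ∣ v} (X^{f(w∣v)} - ρ(s_w))`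
  haveI : Fintype {w : HeightOneSpectrum (𝓞 F) // w.under (𝓞 F₀) = v} :=
    (finite_fibre (F := F) v).fintype
  obtain ⟨𝔔, s, hs, hchar⟩ :=
    FramedGaloisRep.exists_charpoly_induce_eq_prod (K := F₀) hdeg ρ h𝔓 (hIn 𝔓 h𝔓) hσ
  rw [hRchar σ, hchar]
  have hfac : ∀ w : {w : HeightOneSpectrum (𝓞 F) // w.under (𝓞 F₀) = v},
      X ^ (w.1.asIdeal.inertiaDeg (𝓞 F₀)) -
          C (((ρ (s w) : GL (Fin 1) (PadicAlgCl ℓ)) : Matrix (Fin 1) (Fin 1) (PadicAlgCl ℓ)) 0 0) =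
        expand (PadicAlgCl ℓ) (w.1.asIdeal.inertiaDeg (𝓞 F₀)) (P w.1) := by
    intro w
    have hP : FramedRep.charpoly ρ (s w) = P w.1 :=
      (hfib w.1 w.2).2.2 (𝔔 w) (hs w).1 (s w) (hs w).2
    rw [← hP, charpoly_rankOne, expand_X_sub_C]
  rw [Fintype.prod_congr _ _ hfac]
  exact prod_subtype_eq_finprod_mem_setOf (fun w : HeightOneSpectrum (𝓞 F) ↦ w.under (𝓞 F₀) = v)
    (finite_fibre (F := F) v) fun w ↦ expand (PadicAlgCl ℓ) (w.asIdeal.inertiaDeg (𝓞 F₀)) (P w)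

/-- **The rank-one stratum of the crux reduces to place-by-place reciprocity for characters.**
With §9 and `hasQuadraticInduction_one`: if every admissible datum `(π, eψ, ℓ, ι)` of rank one
admits the twisted reciprocity package over `F` (Weil's `ℓ`-adic character of `χ_π ψ⁻¹`, where `ψ`
is the Hecke character of `eψ` by Artin reciprocity), then `HostInducedRepAt 1` holds — the Galois
side contributes nothing conjectural in rank one. -/
theorem hostInducedRepAt_one_of_reciprocity
    (hrec : ∀ (F₀ F : Type) [Field F₀] [NumberField F₀] [Field F] [NumberField F] [Algebra F₀ F]
      (τ : F ≃ₐ[F₀] F), NumberField.IsTotallyReal F₀ → Module.finrank F₀ F = 2 → τ ≠ 1 →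
      ∀ (hcpt : isCompact_glFiniteIntegralLevel 1 F) (π : CuspidalAutomorphicRepData 1 F hcpt)
        (ℓ : ℕ) [Fact ℓ.Prime] (ι : PadicAlgCl ℓ ≃+* ℂ), π.1.IsRegularAlgebraic →
        (∀ w : HeightOneSpectrum (𝓞 F), ((ℓ : ℕ) : 𝓞 F) ∈ w.asIdeal → π.1.IsUnramifiedAt w) →
        ∀ eψ : FramedGaloisRep F ℂ 1, TwistedStrongReciprocityAt π eψ ℓ ι) :
    HostInducedRepAt 1 := by
  intro F₀ F _ _ _ _ _ τ hTR hdeg hτ hcpt π e k hreg _ _ _ ℓ _ ι _ hunr eψ _ _ _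
  exact hostConclusion_of_reciprocity_of_induction π eψ ℓ ι
    (hrec F₀ F τ hTR hdeg hτ hcpt π ℓ ι hreg hunr eψ) (hasQuadraticInduction_one hdeg)

end InductionOne

/-! ## §12 NEW (gen-4): the rank-one stratum of the crux is a THEOREM

With §9 and §11 only the automorphic half `TwistedStrongReciprocityAt π eψ ℓ ι` of the rank-one
stratum remained.  It is discharged here from the tree, with NO class field theory for `eψ`: the
algebraic Hecke character `χ_π` of `π` (`exists_heckeCharacter_glOne`,
`isAlgebraic_heckeCharacter_glOne_of_isCAlgebraic`) has Weil's `ℓ`-adic character `r` with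
place-by-place control (`HeckeCharacter.IsAlgebraic.exists_lAdic`); the Artin character `eψ` has
finite image (`finite_range_toMonoidHom`), hence open kernel, so `g ↦ ι⁻¹(det eψ(g))⁻¹` is a
locally constant — hence continuous — character `χ' : Γ_F →ₜ* ℚ̄_ℓˣ`; the witness is the twist
`r ⊗ χ'` (`FramedRep.twist`), whose Frobenius value at a good `w` is
`(ι⁻¹ c_w)⁻¹ · ι⁻¹(χ_π(ϖ_w))⁻¹ = ι⁻¹((χ_π(ϖ_w) c_w)⁻¹)`, i.e. exactly
`arithFrobPolyOfSatake ι q_w 1 {χ_π(ϖ_w) · c_w}`.  Hence **`HostInducedRepAt 1` holds outright**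
(`hostInducedRepAt_one`): the `n = 1` stratum of the crux is closed positively in Lean (standard
axioms), and the standing verdict "no counterexample in rank `≤ 1`" is now a checked theorem rather
than a paper remark. -/

section RankOne

variable {F : Type} [Field F] [NumberField F] {ℓ : ℕ} [Fact ℓ.Prime]

/-- **Place-by-place reciprocity for the rank-one twists `π ⊗ ψ̃⁻¹` (Weil + finite image of
Artin characters).** -/
theorem twistedStrongReciprocityAt_one {hcpt : isCompact_glFiniteIntegralLevel 1 F}
    (π : CuspidalAutomorphicRepData 1 F hcpt) (hπ : π.1.IsRegularAlgebraic)
    (eψ : FramedGaloisRep F ℂ 1) (ι : PadicAlgCl ℓ ≃+* ℂ) :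
    TwistedStrongReciprocityAt π eψ ℓ ι := by
  classical
  -- Weil's `ℓ`-adic character of the algebraic Hecke character of `π`
  obtain ⟨χ, hχ⟩ := π.1.exists_heckeCharacter_glOne
  have halg : χ.IsAlgebraic :=
    π.1.isAlgebraic_heckeCharacter_glOne_of_isCAlgebraic hχ hπ.isCAlgebraic
  obtain ⟨r, hr⟩ := halg.exists_lAdic ι
  -- `eψ` has finite image, hence open kernel
  haveI : Finite eψ.toMonoidHom.range :=
    Literature.NumberTheory.Automorphic.finite_range_toMonoidHom eψ
  have hker : IsOpen (eψ.toMonoidHom.ker : Set (Field.absoluteGaloisGroup F)) :=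
    isOpen_ker_of_finite_range eψ
  -- `ψ₀ = ι⁻¹ ∘ det eψ`, a locally constant character
  obtain ⟨ψ₀, hψ₀⟩ : ∃ ψ₀ : Field.absoluteGaloisGroup F →* (PadicAlgCl ℓ)ˣ,
      ∀ g, ψ₀ g = Units.map (ι.symm.toRingHom.toMonoidHom) (FramedRep.det eψ g) :=
    ⟨(Units.map (ι.symm.toRingHom.toMonoidHom)).comp (FramedRep.det eψ).toMonoidHom, fun _ ↦ rfl⟩
  have hψ₀val : ∀ g, (ψ₀ g : PadicAlgCl ℓ) = ι.symm ((FramedRep.det eψ g : ℂˣ) : ℂ) := fun g ↦ by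
    rw [hψ₀, Units.coe_map]
    rfl
  have hloc : IsLocallyConstant ψ₀ := by
    refine (IsLocallyConstant.iff_exists_open ψ₀).mpr fun g ↦
      ⟨{y | g⁻¹ * y ∈ eψ.toMonoidHom.ker}, hker.preimage (continuous_const_mul g⁻¹), ?_,
        fun y hy ↦ ?_⟩
    · show g⁻¹ * g ∈ eψ.toMonoidHom.ker
      rw [inv_mul_cancel]
      exact one_mem _
    · have hy' : eψ g = eψ y := by
        have h := (MonoidHom.mem_ker).mp hy
        rw [ContinuousMonoidHom.coe_toMonoidHom, map_mul, map_inv, inv_mul_eq_one] at h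
        exact h
      rw [hψ₀, hψ₀, FramedRep.det_apply, FramedRep.det_apply, hy']
  obtain ⟨χ', hχ'⟩ : ∃ χ' : Field.absoluteGaloisGroup F →ₜ* (PadicAlgCl ℓ)ˣ, ∀ g, χ' g = (ψ₀ g)⁻¹ :=
    ⟨⟨invMonoidHom.comp ψ₀, hloc.continuous.inv⟩, fun _ ↦ rfl⟩
  refine ⟨r.twist χ', FramedRep.isSemisimple_of_rank_one _, fun w α c hwℓ hα hψu hψc ↦ ?_⟩
  -- `χ` is unramified at `w`, Weil's character is controlled there, and `α = {χ(ϖ_w)}`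
  have hur : χ.IsUnramifiedAt w := π.1.isUnramifiedAt_heckeCharacter_glOne hχ hα
  obtain ⟨hrunr, hrfrob⟩ := hr w hwℓ hur
  obtain ⟨ϖ, hϖ, rfl⟩ := π.1.exists_eq_singleton_of_hasSatakeParamAt_glOne hχ hα
  refine ⟨fun 𝔔 h𝔔 τ hτ ↦ ?_, fun 𝔔 h𝔔 σ hσ ↦ ?_⟩
  · -- unramified: both factors die on inertia
    have h1 : r τ = 1 := hrunr 𝔔 h𝔔 τ hτ
    have h2 : eψ τ = 1 := hψu 𝔔 h𝔔 τ hτ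
    have h3 : χ' τ = 1 := by
      rw [hχ', inv_eq_one, hψ₀, FramedRep.det_apply, h2, map_one, map_one]
    rw [FramedRep.twist_apply_of_eq_one _ _ h3, h1]
  · -- Frobenius: `(ι⁻¹ c)⁻¹ · ι⁻¹(χ(ϖ))⁻¹ = ι⁻¹((χ(ϖ) c)⁻¹)`
    have hrσ := hrfrob 𝔔 h𝔔 σ hσ
    rw [charpoly_rankOne, sub_right_inj, C_inj] at hrσ
    have hcσ := hψc 𝔔 h𝔔 σ hσ
    rw [charpoly_rankOne, sub_right_inj, C_inj] at hcσ
    have hdet : ((FramedRep.det eψ σ : ℂˣ) : ℂ) = c := by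
      rw [FramedRep.det_apply, Matrix.GeneralLinearGroup.val_det_apply, Matrix.det_fin_one, hcσ]
    have hval : ((χ (localUnits w ϖ) : ℂˣ) : ℂ) = χ.valueAtUniformizer w := by
      rw [← HeckeCharacter.localComponent_eq_valueAtUniformizer hur hϖ,
        HeckeCharacter.localComponent_apply]
    rw [charpoly_rankOne, FramedRep.coe_twist_apply, Matrix.smul_apply, smul_eq_mul, hrσ,
      Multiset.map_singleton, arithFrobPolyOfSatake_one, Multiset.map_singleton,
      Multiset.prod_singleton, hval, sub_right_inj, C_inj, hχ', Units.val_inv_eq_inv_val, hψ₀val,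
      hdet, mul_inv, map_mul, map_inv₀, map_inv₀, mul_comm]

/-- **The rank-one stratum of the crux, PROVED** (`HostInducedRepAt 1`; standard axioms): §9's
factorisation fed with `twistedStrongReciprocityAt_one` (Weil + finite image) and
`hasQuadraticInduction_one` (Ash's induced Frobenius polynomial + semisimplification).  Every
hypothesis of the crux other than `hdeg`, `hreg`, `hunr`-free data is unused in rank one. -/
theorem hostInducedRepAt_one : HostInducedRepAt 1 :=
  hostInducedRepAt_one_of_reciprocity fun _ _ _ _ _ _ _ _ _ _ _ _ π _ _ ι hreg _ eψ ↦
    twistedStrongReciprocityAt_one π hreg eψ ι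

/-- **The crux is its `n ≥ 2` part**: with the strata `n = 0` (§1) and `n = 1` (§12) proved,
`HostInducedRep ↔ ∀ n ≥ 2, HostInducedRepAt n`.  (By §10 the stratum `n = 2` is moreover a theorem
in print, so the OPEN content of the crux starts at `n = 3`.) -/
theorem hostInducedRep_iff_forall_two_le : HostInducedRep ↔ ∀ n, 2 ≤ n → HostInducedRepAt n := by
  rw [hostInducedRep_iff]
  refine ⟨fun h n _ ↦ h n, fun h n ↦ ?_⟩
  rcases Nat.lt_or_ge n 2 with hn | hn
  · interval_cases n
    · exact hostInducedRepAt_zero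
    · exact hostInducedRepAt_one
  · exact h n hn

end RankOne

/-! ## §10 NEW (gen-4, paper): the rank-two stratum is in print; where the new cases start

**Claim.** Let `F/F₀` be quadratic, `F₀` totally real, `F` of MIXED signature (the route's new case),
`τ` the non-trivial automorphism, and `π` cuspidal regular algebraic on `GL₂/F`, `τ`-polarized:
`π^τ ≅ π^∨ ⊗ (η ∘ N_{F/F₀} ∘ det)` with `η = χ‖·‖^{-k}` algebraic (as typed: Artin avatar `e`, `k : ℤ`).
Then `π ≅ BC_{F/F₀}(π₀) ⊗ λ` with `λ` a finite-order Hecke character of `F` times `|·|^s` and `π₀` a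
PARITIOUS cohomological Hilbert cusp form over `F₀` (every `π₀,ᵥ ≅ D_{k_v} ⊗ (sign)`, `k_v ≥ 2`, all
`k_v` of one parity).  Hence `ρ_π = ρ_{π₀}|_{Γ_F} ⊗ λ̃` exists with unramified compatibility at every
`w ∤ ℓ` (Carayol, Taylor, Blasius–Rogawski; Frobenius polynomials at unramified places), and so do
`ρ_{π ⊗ ψ⁻¹}` and `R = Ind_{Γ_F}^{Γ_{F₀}}(ρ_π ⊗ ẽψ⁻¹)`: **the `n = 2` stratum of `QuadraticWindowA`,
`HostInducedRep` and `TwistUnpackaging` is a theorem in print**, like `n = 1` (CFT/Weil).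

*Proof.*  For `GL₂`, `π^∨ ≅ π ⊗ ω_π⁻¹`, so the polarization reads `π^τ ≅ π ⊗ μ`,
`μ := ω_π⁻¹ (η ∘ N)`; central characters give `ω_π^τ = ω_π⁻¹ (η∘N)²`, whence `μ μ^τ = 1`.
(i) *The class of `μ`.*  Characters of `C_F` with `μ^{1+τ} = 1` are those trivial on
`N'(C_F)`, `N' = (1+τ)` (the norm followed by `C_{F₀} ↪ C_F`); characters of the form `λ^{τ-1}` are
those trivial on `ker(τ-1) = C_F^τ = C_{F₀}` (`H¹(G, F^×) = 0`; and `ker(1+τ) = im(τ-1)` by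
`Ĥ^{-1}(ℤ/2, C_F) ≅ H¹ = 0`, so `λ` is defined on the closed subgroup `im(τ-1)` by `λ((τ-1)x) = μ(x)`
— open mapping — and extended).  Since `N'(C_F) ≤ C_{F₀}` with quotient `C_{F₀}/N_{F/F₀}C_F ≅ ℤ/2`
(norm index), **`μ = λ^{τ-1}` for a quasi-character `λ` iff `μ|_{C_{F₀}} = 1`, the only other
possibility being `μ|_{C_{F₀}} = ω_{F/F₀}`.**  (The naive "Hilbert 90" shortcut is off by exactly this
`ℤ/2`; the second class is the conjugate-symplectic-type class familiar from unitary groups.)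
(ii) *Excluding `ω_{F/F₀}`.*  `F` mixed has a complex place `w₋`, over a real place `v₋` of `F₀`
inert in `F`, so `ω_{F/F₀}((−1)_{v₋}) = sgn(−1) = −1`.  On the other hand
`(η∘N)((−1)_{v₋}) = η_{v₋}(N_{ℂ/ℝ}(−1)) = η_{v₋}(1) = 1`, so `μ((−1)_{v₋}) = ω_{π,w₋}(−1)⁻¹`; the
parameter of `π_{w₋}` is `z^{p₁}z̄^{q₁} ⊕ z^{p₂}z̄^{q₂}` with `pᵢ, qᵢ ∈ ½ + ℤ` (regular algebraic) and
`p₁ + q₁ = p₂ + q₂ = w ∈ ℤ` (Clozel's purity lemma, cuspidal regular algebraic `π` over ANY number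
field), so `ω_{π,w₋}(−1) = (−1)^{2w} = +1 ≠ −1`.  Hence `μ|_{C_{F₀}} = 1` and `μ = λ^{τ-1}`.
(iii) `(π ⊗ λ⁻¹)^τ ≅ π ⊗ μ λ^{-τ} = π ⊗ λ⁻¹` is `τ`-invariant and cuspidal on `GL₂/F`, `[F:F₀] = 2`
prime, so `π ⊗ λ⁻¹ ≅ BC(π₀)`, `π₀` cuspidal on `GL₂/F₀`, unique up to `⊗ ω_{F/F₀}` (Langlands;
Arthur–Clozel Ch. 3 Thm 4.2).
(iv) *Normalising `λ`.*  `μ = ω_π⁻¹(η∘N)` is algebraic with `μμ^τ = 1`, hence of trivial infinity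
type (a field with a real place has only parallel types), hence of FINITE ORDER.  So `λ^{τ-1}` has
finite order: `λ_{w₋}` has no `(z/|z|)^m` component and `λ_w, λ_{τw}` share their `|·|^{s}` at each
split pair; by the unit theorem `Re s` is parallel and the imaginary parts `(a, a, −a, …)` lie in the
lattice dual to `log |N_{F/F₀}(𝓞_F^×)|` — exactly the lattice of infinity types `(|·|^{ia}, |·|^{-ia},
…)` of Hecke characters `ν` of `F₀`; absorbing `ν ∘ N_{F/F₀}` into `π₀` leaves `λ = λ₂ |·|^s` with `λ₂`
of FINITE ORDER.  (v) *Algebraicity of `π₀`.*  `BC(π₀) = π ⊗ λ₂⁻¹ |·|^{-s}` is regular algebraic up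
to `|·|^{s}`: at a real place `w` over a split `v`, `π₀,ᵥ = π_w ⊗ λ₂,w |·|^{-s}` is a twist of
`D_{k_v}`, `k_v ≥ 2`; at `v₋`, `BC_{ℂ/ℝ}(π₀,v₋)` is regular, which excludes principal series (`BC` of
`χ₁ ⊞ χ₂` has parameter `(zz̄)^{s₁} ⊕ (zz̄)^{s₂}`, whose two summands each have equal exponents, so it
is never of the regular shape `{z^p z̄^q, z^q z̄^p}`, `p ≠ q`) and forces `π₀,v₋ ≅ D_{k₋} ⊗ |·|^{u}`,
`k₋ = |p₁ − q₁| + 1 ≥ 2`; `C`-algebraicity of `π` puts `±(k_v−1)/2 + w/2` in `½ + ℤ` at every place,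
so all `k_v` have the same parity: after the parallel twist `|·|^{s - w/2}` the form `π₀` is unitary
discrete series of weight `(k_v)_v` at infinity, paritious.  ∎

**Consequences for the route (information for planner / lead, not a verdict on the typed item).**
* There is NO `τ`-polarized regular algebraic cuspidal `π` on `GL₂/F` beyond twists of base change:
  the route's CHEAPEST FALSIFIER paragraph ("n = 2, F = ℚ(2^{1/4}) … non-base-change π") is vacuous,
  and BCGP Thm 2.7 is not even needed at `n = 2` for polarized `π`.  The first rank with genuinely
  new instances of `QuadraticWindowA` is `n = 3` (e.g. stable base changes to `GL₃/F` from the unitary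
  groups `U_{F/F₀}(3)` of the MIXED quadratic extension — groups with no Shimura variety); `n = 3` is
  odd, so by §8bis the archimedean sign at the non-split real places is automatic there, and the
  first rank at which the engine's residual sign law (route risk (a)) is open is `n = 4`.
* Nearest prior art for the engine's step "base change to the CM field `K = K′F₀`, twist by `ψ₀`,
  read the package on a unitary Shimura variety": Blasius–Rogawski attach `r_{Π,χ,ι} : Γ_M →
  GL₂(ℚ̄_ℓ)`, `M = F₀K′`, to EVERY Hilbert cusp form `Π` over `F₀` of weights `≥ 2` — paritious or
  not — after a Hecke-character twist `χ` of `M` (quoted as Thm 3.2 of Dembélé–Loeffler–Pacetti,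
  *Non-paritious Hilbert modular forms*, Math. Z. (2019), arXiv:1612.06625, doi
  10.1007/s00209-019-02229-5, materialised text p. 9; their Thm 3.5 descends the `L`-group-valued
  representation to `Γ_E` by a lifting lemma for index-two subgroups, Lemma 3.4 ibid.).  This is the
  `GL₂` shadow of the present engine (host: unitary Shimura varieties in three variables) and belongs
  in the route's NOVELTY paragraph next to Mok arXiv:1109.5392 and BCGP arXiv:1812.09269; consistent
  with, not a refutation of, the crux.
* Goldring–Koskivirta re-read (arXiv:1507.05032, materialised pp. 14, 19): Thm 3.5.5 produces
  `R_{p,ι}(π) : Γ_K → GL_m(ℚ̄_p)` for the COEFFICIENT prime `p ∉ Ram(G) ∪ Ram(π)` (Condition 2.4.1: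
  compatibility at `v ∉ Ram(G,π)`, `v ≠ p`, by rational primes).  For the crux's `ℓ` this needs
  `ℓ ∉ Ram(G)` — delivered by `ℓ ∤ disc F` (so `F₀/ℚ` and `F/F₀` are unramified above `ℓ`) once `K′` is
  chosen `ℓ`-unramified — and `π′_ℓ` unramified, i.e. `π`, `ψ` and `ψ₀` unramified above `ℓ` (the crux
  has the first two; `ψ₀` is the prover's choice, BLGGT A.2.5 with a finite set of unramified
  conditions) AND the descent `π′` spherical at the places of `F₀` over `ℓ` inert in `K`; for the
  simple generic parameter of a cuspidal `Π_K` the quotient `S̄_ψ` is trivial, so every member of the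
  global packet is automorphic (Mok Thm 2.5.2) and the spherical member can be selected.  §6
  (rational-prime control set) stands unchanged.
* Search status this cycle: `searchd` (lit search / OpenAlex / S2 / arXiv / zbMATH cascade) rc 75 all
  session — NO verdict is drawn from absence; galaxy up (web-PDF/book corpora: 0 relevant hits for
  "limits of discrete series" + Galois, "neither totally real nor CM"); `lit read` of held texts works
  (GK, DLP read at page level as cited). -/


/-! ## §13 NEW (gen-5): `-- Targets` — the stubs of the two filed lines, and the typed Asai sign

Lines on file (no `PICKED.md` yet): `Lines/one-transparent-pane.lean` (REGISTERED skeleton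
`923c10f3…`, stubs `stub_signPin`, `stub_asaiPoleInduced`, `stub_paneLaw`, `stub_package`,
`stub_galoisOverK`, `stub_patch`, `stub_totallyRealInduction`) and `Lines/grs-explicit-descent.lean`
(stubs `stub_inducedPackage`, `stub_signedTwist`, `stub_grsExplicitDescent`, `stub_gkPlacewise`,
`stub_patchDescend`; registration superseded).  Verdict of the standing adversary, stub by stub
(`T` = true in nature, `L` = Lean fact below, `!` = typed hazard the lead must handle):

* `stub_signPin` (pane, LEVER) — `T`: checked on paper in full for `N = 1` (conjugate self-dual
  Hecke characters: `κ = +1 ⇔ χ|_{𝔸_F^×} = 1 ⇔ a ∈ ℤ`, `κ = -1 ⇔ χ|_{𝔸_F^×} = ω_{E/F} ⇔ a ∈ ½+ℤ`,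
  matching `(N-1)/2 + (1-κ)/4`; the typed local Asai factors give `L^S(s, χ, As⁺) = L^S(s, χ|_{𝔸_F})`),
  and for general `N` by the argument of its docstring, whose two non-obvious steps hold: (i) one
  REAL coset `r + ℤ` plus `Nodup` excludes Stein complementary pairs `χ|·|_ℂ^{±s}`, `0 < s < ½`
  (their exponents differ by `2s ∉ ℤ`) and forces every unitary character `z^p z̄^q` (`p` real,
  `p + q ∈ iℝ`, `p - q ∈ ℤ`) to have `q = -p`, i.e. to be conjugate self-dual ITSELF (`P` is unitary:
  conjugate self-duality forces `Re` of the central twist to vanish); (ii) for pairwise distinct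
  self-dual characters the conjugate-dual form of sign `b = (-1)^{N-1}κ` is diagonal, so each
  `θ_i(-1) = (-1)^{2p_i} = b` (Gan–Gross–Prasad §3; `b` from Mok's `ξ_{χ_κ}`-descent and GGP Thm 8.1).
  `L`/`!`: `HasAsaiPole` is a `∀` over Asai data, hence BOTH signs hold for a `π` with no Asai
  datum (`hasAsaiSign_of_forall_not_isAsaiDatum`); Asai data exist for every `π` once
  `[E:F] = 2`, `c ≠ 1` (`exists_isAsaiDatum`, Flath + finiteness of the different — the stub has
  both hypotheses, so no vacuity); and the pin PROVES the uniqueness half of Mok's dichotomy for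
  pane-type `P` (`SignPin.sign_unique`), so it is at least as strong as
  `Mok2014_partialAsaiL_pole_dichotomy` there — carry that fact as a hypothesis (D-0014).
* `stub_asaiPoleInduced` (pane) — `T`: the Galois identity
  `As^ε_{K/F₀}(Ind_{L/K} ρ) ≅ Ind_{F'/F₀} As^ε_{L/F'} ρ ⊕ Ind_{F/F₀} As^ε_{L/F} ρ` re-checked on all
  four cosets of `Gal(L/F₀)` (incl. `tΓ_L`: both sides `0`; `c̃Γ_L`: `ρ((c̃m)²) + ρ^t((c̃m)²)` on both
  sides); the typed tower hypotheses DO force `L/F₀` biquadratic (`s, t` distinct involutions ⇒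
  `(ℤ/2)²`, `F₀ ⊆ L^s = F'`); the second factor `L^S(P, As^ε_{L/F})` has no pole (a pole ⇒ `P^{c̃} ≅ P^∨
  ≅ P^s` ⇒ `P^t ≅ P` ⇒ `AI(P)` not cuspidal) and no zero at `1` (product = `L(P × P^{c̃}) ≠ 0` on
  `Re s = 1`).  `!`: RAMANUJAN-STRENGTH AS TYPED, see the last bullet.
* `stub_paneLaw` (pane) — `T`, pure logic over the two previous statements + sign existence; the
  arithmetic `½ ≡ (n-1)/2 + (1-κ_P)/4 ⇒ κ_P = (-1)^n` and `HasAsaiSign s ((-1)^n) = HasAsaiPole s (-1)`,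
  `HasAsaiPole cK (-1) = HasAsaiSign cK 1` (rank `2n` even) re-checked.  Needs `χ σ ≠ ∅`
  (`card = n > 0`, supplied) and an Asai datum for uniqueness (`exists_isAsaiDatum`).
* `stub_package` (pane, laundering) — `T` as far as checked: `θ = η'⁻¹` is unramified at every good
  `v` (polarization identity at unramified places: `η'_v ∘ N` unramified on `N(𝓞_w^×) = 𝓞_v^×`), so
  the per-member exceptional sets `E_j` + coverage clause are the right shape (BLGGT A.2.5 controls
  finitely many places only); `T_j` IS weakly regular (multiplicities `≤ 2`) and is EVENLY PAIRED at
  every place over a split-type `v` (`{p_i(τw)} = {wt - p_i(w)} = {p_i(w)}` by the polarization and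
  Clozel purity, `e' = wt` forced by central characters) — so Fakhruddin–Pilloni 9.7 is silent there
  and the pane (complex-type places, exponents `{p_i + a_u} ∪ {q_i + a_u}`) is genuinely needed; the
  parity law "`d_v = e(c_v)` constant on the complex-type real places" for EVEN `n` (§8bis: open) is
  DERIVED by the line from the pin applied to `P_j` (cuspidal, `s`-conjugate self-dual: checked,
  `P_j^s = P_j^∨ ⊗ (η'θ)∘N = P_j^∨`); no counterexample found: for `n = 2` every polarized `π` over an
  `F` with a complex place is `BC(π₀) ⊗ λ` (§10 (i)–(ii) verbatim, CM `F` included) and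
  C-algebraicity forces `m_w ≡ k_v - 1`, whence `d_v = (-1)^{k_v + m_w} = -1` constant even for
  NON-paritious `π₀`; for `n = 1` algebraicity forces constant parity of the unitary type.
  `!`: its conclusion `(τ' j).1.HasAsaiSign … 1` is Ramanujan-strength as typed (last bullet).
  `!!` (typed plumbing, not mathematics): that conclusion — and `IsConjSelfDualAE` next to it — is
  stated w.r.t. `NumberField.IsCMField.complexConj (K j) : K_j ≃ₐ[K_j⁺] K_j`, i.e. over the SUBFIELD
  `K_j⁺ = maximalRealSubfield K_j` (Asai data indexed by `HeightOneSpectrum (𝓞 K_j⁺)`), while the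
  pane law `hpane` delivers `Q.1.HasAsaiSign cK 1` over `F₀` (`cK : K_j ≃ₐ[F₀] K_j`); inside
  `stub_package` the lead must TRANSPORT `IsAsaiDatum`/`partialAsaiL`/`HasAsaiPole` along
  `F₀ ≃+* K_j⁺` (Mathlib `NumberField.CMExtension.equivMaximalRealSubfield`, for `F₀` totally real,
  `K_j` totally complex, `[K_j:F₀] = 2`): a bijection of finite places preserving `residueCard`,
  `under` and the `c`-action — no such transport lemma exists in the tree yet; and an
  `IsCMField (K j)` INSTANCE must be produced for `K_j = F₀(√-d_j)`.  Both are chores, but they sit on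
  the critical path of `HostInducedRep_of`.
* `stub_galoisOverK` (pane) — `T` (= FP 9.10 + Weil + semisimplification); `N = 0` true trivially
  (rank-`0` witness); `!`: the vendored fact `FakhruddinPilloni2021_galoisRep_of_weaklyRegular_odd`
  wants `IsEssConjSelfDual 1` (pairing form) where the stub offers `IsConjSelfDualAE` (needs strong
  multiplicity one), and its clause (2) controls EVERY unramified `u ∤ ℓ` — this is what closes the
  §6 control-set gap, by the strength of the printed FP statement (as far as the disprover can
  tell, GK 3.5.5's `Ram(G)` restriction is a framework restriction — "unramified" is defined there
  through hyperspecial level of the `ℚ`-group, absent over `p ∣ disc F₀` — not a mathematical one at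
  `v ∤ ℓ`; whether FP's printed proof of 9.10 (2) covers such `v` is for an auditor of that fact).
* `stub_patch` (pane) / `stub_patchDescend` (grs) — `T`: the tree's PROVED
  `SorensenPatching.exists_framedGaloisRep` uses exactly the SINGLE-PLACE generality the stubs
  provide (`∀ v ∉ S, infinitely many members split v`; finitely many prime-index subgroups contain a
  given open `U`), so no generality gap; (a)/(b) follow from control on the density-one set of
  degree-one places + Chebotarev + Brauer–Nesbitt.  The abstract `Ctrl` of `stub_patchDescend` admits
  no junk refutation: a doubly-valued `Ctrl v₀` makes hypothesis (H2) fail at any admissible `K`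
  splitting `v₀`, and admissible `K` (`Adm`: finitely many local conditions, totally complex)
  splitting a given `v₀` always exist (weak approximation), so (H2) forces `Ctrl` single-valued.
* `stub_totallyRealInduction` (pane) — `T` (lang.S27 + induction); rank one holds for EVERY `F`
  (`hostConclusion_rank_one`, from §11–§12), rank `0` trivially; total reality is used only to
  invoke HLTT.
* `stub_inducedPackage`, `stub_signedTwist`, `stub_grsExplicitDescent`, `stub_gkPlacewise` (grs) —
  `T` as far as checked (`ℓ ∤ disc F ⇒ ℓ ∤ disc F₀` by `disc F = disc F₀² · N(𝔡_{F/F₀})`; `η`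
  unramified above `ℓ` follows from `ℓ ∤ disc F` + `hunr` by the same unramified-polarization
  argument; `HalfIntShape` at EVERY complex embedding of `K` = the same parity law as the pane's
  type I); `!`: `SignedTwistSpec` (b) `τ'.1.HasAsaiSign cK 1` is Ramanujan-strength as typed.
* **The typed Asai sign is Ramanujan-strength** (`!`, both lines).  `HasAsaiPole π c η` asks the RAW
  partial Euler product `partialAsaiL S c A η` (a `tprod`, junk value `1` where not multipliable) to
  satisfy `(s-1)L → r ≠ 0` from `Re s > 1`, for every Asai datum.  For rank `≥ 3` multipliability on
  `1 < Re s ≤ 3/2` is not in print (Rankin–Selberg `L²` control + Cauchy–Schwarz reach `Re s > 3/2`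
  only; tree file `AsaiSignContinuation.lean`, which flags `Mok2014_partialAsaiL_pole_dichotomy` as
  stronger than Mok/Grbac–Shahidi and proves the reduction
  `Mok2014_partialAsaiL_pole_dichotomy_of_continuation` from the continued form + holomorphy of the
  raw product on `{1 < Re s}`).  `not_hasAsaiPole_of_frequently_not_multipliable`: ONE datum whose raw
  product is non-multipliable at points accumulating at `1⁺` kills the typed pole for BOTH signs.
  (Ranks `1, 2` are harmless: Hecke `L`-functions, resp. automorphy of `As : GL₂ → GL₄`
  (Krishnamurthy 2003 / Ramakrishnan 2002) make the raw products converge absolutely on `Re s > 1`;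
  the crux's open content starts at `n = 3`, §10/§12, exactly where this bites.)
  The representations whose sign the lines must PRODUCE (`τ'_j = Π_{K_j} ⊗ ψ₀`, rank `2n`; `P_j`,
  rank `n`) are not known to be tempered (that is the point of the route), so for `n ≥ 2` the
  obligations `HasAsaiSign … 1` of `stub_package` / `SignedTwistSpec` are covered by NO printed
  theorem as typed; they are dischargeable only modulo the over-strong named fact
  `Mok2014_partialAsaiL_pole_dichotomy` (then typed signs exist and are unique —
  `exists_hasAsaiSign`, `existsUnique_hasAsaiSign` — and the pane logic runs).  Recommendation to
  the lead: thread `hMok : Mok2014_partialAsaiL_pole_dichotomy` (or the corrected pair `h`, `hhol` of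
  `AsaiSignContinuation`) through stubs 1–5 / S2–S3 explicitly; nothing in nature is refuted
  (under Ramanujan the typed and printed signs agree), and no `¬stub` is provable for the same reason.
-/

section Targets

open scoped Classical Topology

variable {F E : Type} [Field F] [NumberField F] [Field E] [NumberField E] [Algebra F E]
  {N : ℕ} {hcpt : isCompact_glFiniteIntegralLevel N E}

/-- **Vacuity hazard of the typed pole predicate.**  `HasAsaiPole` quantifies over Asai data; a
representation datum with NO Asai datum has a pole at `s = 1` for BOTH signs. -/
theorem hasAsaiPole_of_forall_not_isAsaiDatum (π : AutomorphicRepData (AutomorphyDatum.gl N E hcpt))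
    (c : E ≃ₐ[F] E) (h : ∀ S A, ¬ π.IsAsaiDatum c S A) (η : ℤˣ) : π.HasAsaiPole c η :=
  fun S A hSA ↦ (h S A hSA).elim

/-- … hence BOTH Asai signs (so the conclusions of `stub_signPin` for `κ = 1` and `κ = -1`, which are
incompatible on a nonempty `χ σ`, would both be due). -/
theorem hasAsaiSign_of_forall_not_isAsaiDatum (π : AutomorphicRepData (AutomorphyDatum.gl N E hcpt))
    (c : E ≃ₐ[F] E) (h : ∀ S A, ¬ π.IsAsaiDatum c S A) (κ : ℤˣ) : π.HasAsaiSign c κ :=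
  hasAsaiPole_of_forall_not_isAsaiDatum π c h _

/-- **Asai data exist** for every automorphic representation datum of `GL_N(𝔸_E)` over a quadratic
`E/F` with non-trivial `c` (the hazard above never bites the stubs, which carry `[E:F] = 2`,
`c ≠ 1`): take `S` = the places of `F` ramified in `E` (finitely many: prime factors of the
different, `finite_setOf_not_isUnramifiedIn`) together with the places below the finitely many
places where `π` has no Satake parameter (Flath, `hasSatakeParamAt_cofinite_holds`, PROVED), and
`A w` = the Satake parameter where there is one; a `c`-fixed place above `v ∉ S` is then inert with
`f = 2` (§3b `inertiaDeg_eq_two_of_smul_eq`).  This is the input "an Asai datum exists by Flath +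
finiteness of ramification" of `stub_paneLaw`'s docstring, now a lemma. -/
theorem exists_isAsaiDatum (h2 : Module.finrank F E = 2) {c : E ≃ₐ[F] E} (hc : c ≠ 1)
    (π : AutomorphicRepData (AutomorphyDatum.gl N E hcpt)) :
    ∃ (S : Set (HeightOneSpectrum (𝓞 F))) (A : SatakeFamily E), π.IsAsaiDatum c S A := by
  classical
  set B : Set (HeightOneSpectrum (𝓞 E)) := {w | ¬ π.IsUnramifiedAt w} with hB
  have hBfin : B.Finite := by
    have h := AutomorphicRepData.hasSatakeParamAt_cofinite_holds π
    rwa [AutomorphicRepData.hasSatakeParamAt_cofinite, Filter.eventually_cofinite] at h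
  set R : Set (HeightOneSpectrum (𝓞 F)) := {v | ¬ Algebra.IsUnramifiedIn (𝓞 E) v.asIdeal} with hR
  have hRfin : R.Finite :=
    Literature.NumberTheory.GaloisRepresentations.finite_setOf_not_isUnramifiedIn F E
  refine ⟨R ∪ (fun w ↦ w.under (𝓞 F)) '' B,
    fun w ↦ if h : π.IsUnramifiedAt w then h.choose else 0, hRfin.union (hBfin.image _), ?_, ?_⟩
  · intro w hw
    have hunr : π.IsUnramifiedAt w := by
      by_contra hw'
      exact hw (Or.inr ⟨w, hw', rfl⟩)
    simp only [dif_pos hunr]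
    exact hunr.choose_spec
  · intro w hw hcw
    have hunrIn : Algebra.IsUnramifiedIn (𝓞 E) (w.under (𝓞 F)).asIdeal := by
      by_contra hv
      exact hw (Or.inl hv)
    refine inertiaDeg_eq_two_of_smul_eq h2 hc (mem_fibre.mpr rfl) hcw fun w' hw' ↦ ?_
    haveI := w'.isPrime
    have hlo : w'.asIdeal.LiesOver (w.under (𝓞 F)).asIdeal :=
      ⟨by rw [← mem_fibre.mp hw', HeightOneSpectrum.under_asIdeal]⟩
    exact (Algebra.isUnramifiedIn_iff_forall_ramificationIdx_eq_one.mp hunrIn) w'.asIdeal hlo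

/-- **One bad datum kills the typed pole for both signs.**  If for some Asai datum `(S, A)` the raw
partial Asai Euler product is not multipliable at points `s` accumulating at `1` inside
`{1 < Re s}`, then `partialAsaiL S c A η s = 1` there (junk value of `tprod`), `(s-1)·1 → 0`, and
`HasAsaiPole c η` fails — for every `η`.  For rank `≥ 3` multipliability on `1 < Re s ≤ 3/2` is
Ramanujan-strength (tree `AsaiSignContinuation.lean`); so every stub obligation `HasAsaiSign … 1`
on a representation not known to be tempered is, AS TYPED, beyond print. -/
theorem not_hasAsaiPole_of_frequently_not_multipliable
    (π : AutomorphicRepData (AutomorphyDatum.gl N E hcpt)) (c : E ≃ₐ[F] E)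
    {S : Set (HeightOneSpectrum (𝓞 F))} {A : SatakeFamily E} (hSA : π.IsAsaiDatum c S A) (η : ℤˣ)
    (h : ∃ᶠ s in 𝓝[{s : ℂ | 1 < s.re}] 1,
      ¬ Multipliable fun v : {v : HeightOneSpectrum (𝓞 F) // v ∉ S} =>
        ((asaiLocalPolynomial c A η (placeAbove E v.1)).eval ((v.1.residueCard : ℂ) ^ (-s)))⁻¹) :
    ¬ π.HasAsaiPole c η := by
  intro hpole
  obtain ⟨r, hr, hlim⟩ := hpole hSA
  set L : Filter ℂ := 𝓝[{s : ℂ | 1 < s.re}] 1 with hL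
  set T : Set ℂ := {s | ¬ Multipliable fun v : {v : HeightOneSpectrum (𝓞 F) // v ∉ S} =>
    ((asaiLocalPolynomial c A η (placeAbove E v.1)).eval ((v.1.residueCard : ℂ) ^ (-s)))⁻¹} with hT
  haveI hne : (L ⊓ 𝓟 T).NeBot := Filter.frequently_iff_neBot.mp h
  have h1 : Tendsto (fun s ↦ (s - 1) * partialAsaiL S c A η s) (L ⊓ 𝓟 T) (𝓝 r) :=
    hlim.mono_left inf_le_left
  have h0 : Tendsto (fun s : ℂ ↦ s - 1) (L ⊓ 𝓟 T) (𝓝 0) :=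
    tendsto_sub_one_nhdsWithin_one_lt_re.mono_left inf_le_left
  have heq : (fun s : ℂ ↦ s - 1) =ᶠ[L ⊓ 𝓟 T] fun s ↦ (s - 1) * partialAsaiL S c A η s := by
    refine Filter.eventually_inf_principal.mpr (Filter.Eventually.of_forall fun s hs ↦ ?_)
    show s - 1 = (s - 1) * partialAsaiL S c A η s
    unfold partialAsaiL
    rw [tprod_eq_one_of_not_multipliable hs, mul_one]
  exact hr (tendsto_nhds_unique h1 (h0.congr' heq))

/-- The statement of the line's lever `stub_signPin`, verbatim (the Asai sign pins the coset of the
archimedean exponents at a `c`-fixed complex place). -/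
def SignPin : Prop :=
  ∀ (F E : Type) [Field F] [NumberField F] [Field E] [NumberField E] [Algebra F E]
    (c : E ≃ₐ[F] E), Module.finrank F E = 2 → c ≠ 1 →
  ∀ (N : ℕ) (hcpt : isCompact_glFiniteIntegralLevel N E) (P : CuspidalAutomorphicRepData N E hcpt)
    (κ : ℤˣ) (χ : (E →+* ℂ) → Multiset ℂ) (σ : E →+* ℂ) (r : ℝ),
    0 < N → P.1.IsConjSelfDualAE c → P.1.HasAsaiSign c κ → P.1.HasArchParameter χ →
    NumberField.ComplexEmbedding.IsConj σ c → (χ σ).Nodup →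
    (∀ a ∈ χ σ, ∃ m : ℤ, a = (m : ℂ) + (r : ℂ)) →
    ∀ a ∈ χ σ, ∃ m : ℤ, a = (m : ℂ) + ((N : ℂ) - 1) / 2 + (1 - ((κ : ℤ) : ℂ)) / 4

/-- The two cosets pinned by `κ = 1` and `κ = -1` are disjoint (`(1-κ)/4 ∈ {0, ½}`; they differ
by `½ ∉ ℤ`). -/
theorem signPin_cosets_disjoint (N : ℕ) (a : ℂ)
    (h₁ : ∃ m : ℤ, a = (m : ℂ) + ((N : ℂ) - 1) / 2 + (1 - (((1 : ℤˣ) : ℤ) : ℂ)) / 4)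
    (h₂ : ∃ m : ℤ, a = (m : ℂ) + ((N : ℂ) - 1) / 2 + (1 - (((-1 : ℤˣ) : ℤ) : ℂ)) / 4) : False := by
  obtain ⟨m₁, hm₁⟩ := h₁
  obtain ⟨m₂, hm₂⟩ := h₂
  have h : ((2 * (m₁ - m₂) : ℤ) : ℂ) = ((1 : ℤ) : ℂ) := by
    push_cast
    rw [hm₁] at hm₂
    push_cast at hm₂
    linear_combination 2 * hm₂
  exact absurd (Int.cast_injective h) (by omega)

/-- **The pin proves the uniqueness half of Mok's dichotomy for pane-type `P`.**  Under `SignPin`,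
a cuspidal conjugate self-dual `P` (`N ≥ 1`) over a quadratic `E/F` with a `c`-fixed complex place
`σ` showing a multiplicity-free, NONEMPTY set of exponents in one real coset has AT MOST ONE typed
Asai sign.  So any proof of `stub_signPin` establishes, for such `P`, what the tree can currently
only take from the named fact `Mok2014_partialAsaiL_pole_dichotomy` (`hasAsaiPole_unique`): the
stub is to be proved MODULO that fact (reshape: add the hypothesis), not outright. -/
theorem SignPin.sign_unique (hpin : SignPin) {c : E ≃ₐ[F] E} (h2 : Module.finrank F E = 2)
    (hc : c ≠ 1) (P : CuspidalAutomorphicRepData N E hcpt) (hN : 0 < N)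
    (hcsd : P.1.IsConjSelfDualAE c) {χ : (E →+* ℂ) → Multiset ℂ} (hχ : P.1.HasArchParameter χ)
    {σ : E →+* ℂ} (hσ : NumberField.ComplexEmbedding.IsConj σ c) (hnd : (χ σ).Nodup) {r : ℝ}
    (hcoset : ∀ a ∈ χ σ, ∃ m : ℤ, a = (m : ℂ) + (r : ℂ)) {a : ℂ} (ha : a ∈ χ σ)
    {κ κ' : ℤˣ} (hκ : P.1.HasAsaiSign c κ) (hκ' : P.1.HasAsaiSign c κ') : κ = κ' := by
  have h := fun (θ : ℤˣ) (hθ : P.1.HasAsaiSign c θ) ↦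
    hpin F E c h2 hc N hcpt P θ χ σ r hN hcsd hθ hχ hσ hnd hcoset a ha
  rcases Int.units_eq_one_or κ with rfl | rfl <;> rcases Int.units_eq_one_or κ' with rfl | rfl
  · rfl
  · exact (signPin_cosets_disjoint N a (h 1 hκ) (h (-1) hκ')).elim
  · exact (signPin_cosets_disjoint N a (h 1 hκ') (h (-1) hκ)).elim
  · rfl

/-- Corollary (the pin also consumes Flath): under `SignPin`, a pane-type `P` as above necessarily
ADMITS an Asai datum — otherwise both signs hold vacuously and `1 = -1`.  (Outright true by
`exists_isAsaiDatum`; recorded to show which tree facts any proof of the stub touches.) -/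
theorem SignPin.exists_isAsaiDatum (hpin : SignPin) {c : E ≃ₐ[F] E} (h2 : Module.finrank F E = 2)
    (hc : c ≠ 1) (P : CuspidalAutomorphicRepData N E hcpt) (hN : 0 < N)
    (hcsd : P.1.IsConjSelfDualAE c) {χ : (E →+* ℂ) → Multiset ℂ} (hχ : P.1.HasArchParameter χ)
    {σ : E →+* ℂ} (hσ : NumberField.ComplexEmbedding.IsConj σ c) (hnd : (χ σ).Nodup) {r : ℝ}
    (hcoset : ∀ a ∈ χ σ, ∃ m : ℤ, a = (m : ℂ) + (r : ℂ)) {a : ℂ} (ha : a ∈ χ σ) :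
    ∃ (S : Set (HeightOneSpectrum (𝓞 F))) (A : SatakeFamily E), P.1.IsAsaiDatum c S A := by
  by_contra hno
  push Not at hno
  have hboth := hasAsaiSign_of_forall_not_isAsaiDatum P.1 c hno
  exact absurd (hpin.sign_unique h2 hc P hN hcsd hχ hσ hnd hcoset ha (hboth 1) (hboth (-1)))
    (by decide)

end Targets

section TargetsRankOne

variable {F₀ F : Type} [Field F₀] [NumberField F₀] [Field F] [NumberField F] [Algebra F₀ F]
  {ℓ : ℕ} [Fact ℓ.Prime]

/-- **`stub_totallyRealInduction` in rank one holds for EVERY quadratic `F/F₀`** (no total reality,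
no cuspidality input beyond the datum): the host conclusion for `(π, eψ)` in rank `1` is §12's
`twistedStrongReciprocityAt_one` fed to §9/§11.  The stub's total-reality hypothesis only serves to
invoke Harris–Lan–Taylor–Thorne in rank `≥ 2`. -/
theorem hostConclusion_rank_one (hdeg : Module.finrank F₀ F = 2)
    {hcpt : isCompact_glFiniteIntegralLevel 1 F} (π : CuspidalAutomorphicRepData 1 F hcpt)
    (hreg : π.1.IsRegularAlgebraic) (eψ : FramedGaloisRep F ℂ 1) (ι : PadicAlgCl ℓ ≃+* ℂ) :
    HostConclusion F₀ F 1 hcpt π eψ ℓ ι :=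
  hostConclusion_of_reciprocity_of_induction π eψ ℓ ι (twistedStrongReciprocityAt_one π hreg eψ ι)
    (hasQuadraticInduction_one hdeg)

end TargetsRankOne

end Summit.Langlands.Langlands.Cruxes.HostInducedRep.Disproof

end
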